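import Mathlib.Analysis.Calculus.BumpFunction.FiniteDimension
import Literature.Analysis.FluidPDE.SereginZajaczkowski2007L42Meridian
import Literature.Analysis.Calculus.DivCurlPlane
import HarnessLib

/-!
# Seregin–Zajaczkowski 2007, Lemma 4.2: the kinematic half, proved

This file DISCHARGES the named fact `SereginZajaczkowski2007.PoloidalLqOfVorticityL2`
(`SereginZajaczkowski2007L42.lean`), the second half of the printed proof of G. Seregin,
W. Zajaczkowski, SIAM J. Math. Anal. 39 (2007) 669–685 = arXiv:math/0702720, Lemma 4.2
(arXiv pp. 5–6): for a field `u` which is smooth, axially symmetric and divergence free at the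
points of the shell `𝒞½ = 𝒞(9/32, 23/8; 15/8)`, with `∫_{𝒞½} |ω_φ|² dx ≤ M` and
`∫_{𝒞½} |u|² dx ≤ E`, the poloidal speed `|u^a| = √(u_ϱ² + u₃²)` obeys
`∫_{𝒞̃₁} |u^a|^q dx ≤ Φ₄(q, M, E)` on `𝒞̃₁ = 𝒞(5/16, 11/4; 7/4)` for every real `q ≥ 1`, with
`Φ₄` non-decreasing in each variable.

## Proof (the printed one, "(4.6), (4.7) ⇒ ∫∫ |∇_a Ṽ|² ≤ c ∫∫ (|χ̃|² + |V^a|²) ⇒ ∫∫ |Ṽ|^q ≤ Φ₄")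

Fix once and for all a planar cut-off `Ψ(ϱ, z) = ψ₁(ϱ) ψ₂(z)` (products of Mathlib bump
functions, `cutoffΨ`) equal to `1` on `[5/16, 11/4] × [-7/4, 7/4]` and supported in the open
rectangle `]9/32, 23/8[ × ]-15/8, 15/8[` — the meridian section of `𝒞½` — and a second one
`Θ` (`cutoffΘ`) equal to `1` on the support of `Ψ`. In the meridian half-plane consider the
profiles `a = Ψ · (u₀ ∘ meridianPoint)`, `b = Ψ · (u₂ ∘ meridianPoint)` of the cut-off poloidal
field `Ṽ = Ψ V^a` (at the meridian points `(ϱ, 0, z)` the cylindrical frame is the standard one,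
`V_ϱ = u₀`, `V₃ = u₂`). They are smooth with compact support, and by (4.3)–(4.4)
(`divergence_meridianPoint`, `angularVorticity_meridianPoint` with `div u = 0`)

  `∂_ϱ a + ∂_z b = Ψ_ϱ u₀ + Ψ_z u₂ - Ψ u₀/ϱ`   (4.6),
  `∂_z a - ∂_ϱ b = Ψ_z u₀ - Ψ_ϱ u₂ + Ψ ω_φ`    (4.7),

so the `div`–`curl` identity (accepted `Calculus.integral_div_sq_add_curl_sq`) gives
`∫∫ |∇(a,b)|² = ∫∫ (div² + curl²) ≤ c ∫∫ Θ |u|² + 3 ∫∫ Ψ² ω_φ²`, and the two planar integrals are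
at most `2/(c₂ · 9/32)` times `∫_{𝒞½} |u|² dx ≤ E` and `∫_{𝒞½} ω_φ² dx ≤ M` (`dx = ϱ dϱ dφ dz` with
`ϱ ≥ 9/32`; accepted `integral_profile_le_mul_integral`). The planar Sobolev inequalities for even
exponents (accepted `exists_planar_even_moment_const`) bound `∫∫ a^{2m}`, `∫∫ b^{2m}` by
polynomials in `(M, E)`; going back to `ℝ³` on `𝒞̃₁` (where `Ψ = 1` and
`|u^a|² = (a² + b²) ∘ meridian`; accepted `integral_le_mul_integral_profile`) bounds
`∫_{𝒞̃₁} |u^a|^{2m} dx`, and a real exponent `q ≥ 1` is handled by `|t|^q ≤ 1 + |t|^{2⌈q⌉}`.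
`Φ₄(q, M, E) = |𝒞̃₁| + Σ_{m ≤ ⌈q⌉} B_m(M, E)` is non-decreasing in each variable.

## References

* G. Seregin, W. Zajaczkowski, SIAM J. Math. Anal. 39 (2007) 669–685, arXiv:math/0702720, proof
  of Lemma 4.2, (4.3), (4.4), (4.6), (4.7) and the last two displays. [`SereginZajaczkowski2007`]
-/

noncomputable section

open MeasureTheory Set Function Filter Topology TopologicalSpace Metric WithLp
open scoped NNReal ENNReal ContDiff InnerProductSpace RealInnerProductSpace

namespace Literature.Analysis.FluidPDE

namespace SereginZajaczkowski2007

open SereginSverak2009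

/-- Local notation for physical space `ℝ³ = EuclideanSpace ℝ (Fin 3)`. -/
local notation "ℝ³" => EuclideanSpace ℝ (Fin 3)

/-! ### The planar cut-offs -/

/-- The radial factor of the cut-off `Ψ`: a bump equal to `1` on `[5/16, 11/4]` and supported in
`]19/64, 177/64[`. [cite: SereginZajaczkowski2007, proof of Lemma 4.2 (the cut-off ψ)] -/
def bumpRho : ContDiffBump (49 / 32 : ℝ) := ⟨39 / 32, 79 / 64, by norm_num, by norm_num⟩

/-- The axial factor of the cut-off `Ψ`: a bump equal to `1` on `[-7/4, 7/4]` and supported in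
`]-29/16, 29/16[`. [cite: SereginZajaczkowski2007, proof of Lemma 4.2 (the cut-off ψ)] -/
def bumpZ : ContDiffBump (0 : ℝ) := ⟨7 / 4, 29 / 16, by norm_num, by norm_num⟩

/-- The radial factor of the auxiliary cut-off `Θ`: equal to `1` on the support of `bumpRho`,
supported in `]37/128, 355/128[ ⊂ ]9/32, 23/8[`. [folklore] -/
def bumpRho' : ContDiffBump (49 / 32 : ℝ) := ⟨79 / 64, 159 / 128, by norm_num, by norm_num⟩

/-- The axial factor of the auxiliary cut-off `Θ`: equal to `1` on the support of `bumpZ`,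
supported in `]-59/32, 59/32[ ⊂ ]-15/8, 15/8[`. [folklore] -/
def bumpZ' : ContDiffBump (0 : ℝ) := ⟨29 / 16, 59 / 32, by norm_num, by norm_num⟩

/-- **The planar cut-off `Ψ(ϱ, z) = ψ₁(ϱ) ψ₂(z)`** of the proof of Lemma 4.2 ("a non-negative
smooth … cut-off function", here in the meridian variables and at a fixed time): smooth,
`0 ≤ Ψ ≤ 1`, `Ψ = 1` on the meridian section `[5/16, 11/4] × [-7/4, 7/4]` of `𝒞̃₁`, supported in
the meridian section `]9/32, 23/8[ × ]-15/8, 15/8[` of `𝒞½`.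
[cite: SereginZajaczkowski2007, proof of Lemma 4.2 (the cut-off ψ)] -/
def cutoffΨ (q : ℝ × ℝ) : ℝ := bumpRho q.1 * bumpZ q.2

/-- The auxiliary cut-off `Θ`, equal to `1` on the support of `Ψ` and supported in the meridian
section of `𝒞½`; it dominates `Ψ²` and `|∇Ψ|²`. [folklore] -/
def cutoffΘ (q : ℝ × ℝ) : ℝ := bumpRho' q.1 * bumpZ' q.2

/-- The open meridian section `]9/32, 23/8[ × ]-15/8, 15/8[` of the shell `𝒞½`. [folklore] -/
def rectHalf : Set (ℝ × ℝ) := Ioo (9 / 32 : ℝ) (23 / 8) ×ˢ Ioo (-(15 / 8 : ℝ)) (15 / 8)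

/-- `Ψ` is smooth. [folklore] -/
theorem contDiff_cutoffΨ {n : ℕ∞} : ContDiff ℝ n cutoffΨ :=
  (bumpRho.contDiff.comp contDiff_fst).mul (bumpZ.contDiff.comp contDiff_snd)

/-- `Θ` is smooth. [folklore] -/
theorem contDiff_cutoffΘ {n : ℕ∞} : ContDiff ℝ n cutoffΘ :=
  (bumpRho'.contDiff.comp contDiff_fst).mul (bumpZ'.contDiff.comp contDiff_snd)

/-- `Ψ` is continuous. [folklore] -/
theorem continuous_cutoffΨ : Continuous cutoffΨ := (contDiff_cutoffΨ (n := 0)).continuous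

/-- `Θ` is continuous. [folklore] -/
theorem continuous_cutoffΘ : Continuous cutoffΘ := (contDiff_cutoffΘ (n := 0)).continuous

/-- `0 ≤ Ψ`. [folklore] -/
theorem cutoffΨ_nonneg (q : ℝ × ℝ) : 0 ≤ cutoffΨ q := mul_nonneg bumpRho.nonneg bumpZ.nonneg

/-- `Ψ ≤ 1`. [folklore] -/
theorem cutoffΨ_le_one (q : ℝ × ℝ) : cutoffΨ q ≤ 1 :=
  mul_le_one₀ bumpRho.le_one bumpZ.nonneg bumpZ.le_one

/-- `0 ≤ Θ`. [folklore] -/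
theorem cutoffΘ_nonneg (q : ℝ × ℝ) : 0 ≤ cutoffΘ q := mul_nonneg bumpRho'.nonneg bumpZ'.nonneg

/-- `Θ ≤ 1`. [folklore] -/
theorem cutoffΘ_le_one (q : ℝ × ℝ) : cutoffΘ q ≤ 1 :=
  mul_le_one₀ bumpRho'.le_one bumpZ'.nonneg bumpZ'.le_one

/-- `Ψ = 1` on the meridian section of `𝒞̃₁ = 𝒞(5/16, 11/4; 7/4)`. [folklore] -/
theorem cutoffΨ_eq_one {q : ℝ × ℝ} (h1 : q.1 ∈ Icc (5 / 16 : ℝ) (11 / 4)) (h2 : |q.2| ≤ 7 / 4) :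
    cutoffΨ q = 1 := by
  have hr : bumpRho.rIn = 39 / 32 := rfl
  rw [cutoffΨ, bumpRho.one_of_mem_closedBall, bumpZ.one_of_mem_closedBall, one_mul]
  · rw [mem_closedBall, dist_zero_right, Real.norm_eq_abs]
    exact h2
  · rw [mem_closedBall, Real.dist_eq, abs_le, hr]
    constructor <;> linarith [h1.1, h1.2]

/-- Where `Ψ ≠ 0`: `19/64 < ϱ < 177/64` and `|z| < 29/16`. [folklore] -/
theorem mem_of_cutoffΨ_ne_zero {q : ℝ × ℝ} (h : cutoffΨ q ≠ 0) :
    q.1 ∈ Ioo (19 / 64 : ℝ) (177 / 64) ∧ |q.2| < 29 / 16 := by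
  obtain ⟨h1, h2⟩ := mul_ne_zero_iff.1 h
  have h1' : q.1 ∈ support (bumpRho : ℝ → ℝ) := h1
  have h2' : q.2 ∈ support (bumpZ : ℝ → ℝ) := h2
  rw [bumpRho.support_eq, mem_ball, Real.dist_eq] at h1'
  rw [bumpZ.support_eq, mem_ball, dist_zero_right, Real.norm_eq_abs] at h2'
  refine ⟨?_, h2'⟩
  have := abs_lt.1 h1'
  constructor <;> norm_num [bumpRho] at this ⊢ <;> linarith [this.1, this.2]

/-- The support of `Ψ` lies in the closed rectangle `[19/64, 177/64] × [-29/16, 29/16]`.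
[folklore] -/
theorem tsupport_cutoffΨ_subset :
    tsupport cutoffΨ ⊆ Icc (19 / 64 : ℝ) (177 / 64) ×ˢ Icc (-(29 / 16 : ℝ)) (29 / 16) := by
  refine closure_minimal (fun q hq => ?_) (isClosed_Icc.prod isClosed_Icc)
  obtain ⟨h1, h2⟩ := mem_of_cutoffΨ_ne_zero hq
  exact ⟨⟨h1.1.le, h1.2.le⟩, abs_le.1 h2.le⟩

/-- The support of `Ψ` lies in the open meridian section of `𝒞½`. [folklore] -/
theorem tsupport_cutoffΨ_subset_rectHalf : tsupport cutoffΨ ⊆ rectHalf := by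
  refine tsupport_cutoffΨ_subset.trans ?_
  rintro ⟨ρ, z⟩ ⟨⟨h1, h2⟩, h3, h4⟩
  refine ⟨⟨by linarith, by linarith⟩, by linarith, by linarith⟩

/-- `Θ = 1` on the support of `Ψ`. [folklore] -/
theorem cutoffΘ_eq_one_of_mem_tsupport {q : ℝ × ℝ} (hq : q ∈ tsupport cutoffΨ) : cutoffΘ q = 1 := by
  obtain ⟨⟨h1, h2⟩, h3, h4⟩ := tsupport_cutoffΨ_subset hq
  rw [cutoffΘ, bumpRho'.one_of_mem_closedBall, bumpZ'.one_of_mem_closedBall, one_mul]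
  · rw [mem_closedBall, dist_zero_right, Real.norm_eq_abs, abs_le]
    exact ⟨by norm_num [bumpZ']; linarith, by norm_num [bumpZ']; linarith⟩
  · rw [mem_closedBall, Real.dist_eq, abs_le]
    exact ⟨by norm_num [bumpRho']; linarith, by norm_num [bumpRho']; linarith⟩

/-- Where `Θ ≠ 0`: `37/128 < ϱ < 355/128` and `|z| < 59/32`. [folklore] -/
theorem mem_of_cutoffΘ_ne_zero {q : ℝ × ℝ} (h : cutoffΘ q ≠ 0) :
    q.1 ∈ Ioo (37 / 128 : ℝ) (355 / 128) ∧ |q.2| < 59 / 32 := by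
  obtain ⟨h1, h2⟩ := mul_ne_zero_iff.1 h
  have h1' : q.1 ∈ support (bumpRho' : ℝ → ℝ) := h1
  have h2' : q.2 ∈ support (bumpZ' : ℝ → ℝ) := h2
  rw [bumpRho'.support_eq, mem_ball, Real.dist_eq] at h1'
  rw [bumpZ'.support_eq, mem_ball, dist_zero_right, Real.norm_eq_abs] at h2'
  refine ⟨?_, h2'⟩
  have := abs_lt.1 h1'
  constructor <;> norm_num [bumpRho'] at this ⊢ <;> linarith [this.1, this.2]

/-- The support of `Θ` lies in the closed rectangle `[37/128, 355/128] × [-59/32, 59/32]`.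
[folklore] -/
theorem tsupport_cutoffΘ_subset :
    tsupport cutoffΘ ⊆ Icc (37 / 128 : ℝ) (355 / 128) ×ˢ Icc (-(59 / 32 : ℝ)) (59 / 32) := by
  refine closure_minimal (fun q hq => ?_) (isClosed_Icc.prod isClosed_Icc)
  obtain ⟨h1, h2⟩ := mem_of_cutoffΘ_ne_zero hq
  exact ⟨⟨h1.1.le, h1.2.le⟩, abs_le.1 h2.le⟩

/-- The support of `Θ` lies in the open meridian section of `𝒞½`. [folklore] -/
theorem tsupport_cutoffΘ_subset_rectHalf : tsupport cutoffΘ ⊆ rectHalf := by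
  refine tsupport_cutoffΘ_subset.trans ?_
  rintro ⟨ρ, z⟩ ⟨⟨h1, h2⟩, h3, h4⟩
  refine ⟨⟨by linarith, by linarith⟩, by linarith, by linarith⟩

/-- `Ψ` has compact support. [folklore] -/
theorem hasCompactSupport_cutoffΨ : HasCompactSupport cutoffΨ :=
  HasCompactSupport.of_support_subset_isCompact (isCompact_Icc.prod isCompact_Icc)
    ((subset_tsupport _).trans tsupport_cutoffΨ_subset)

/-- `Θ` has compact support. [folklore] -/
theorem hasCompactSupport_cutoffΘ : HasCompactSupport cutoffΘ :=
  HasCompactSupport.of_support_subset_isCompact (isCompact_Icc.prod isCompact_Icc)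
    ((subset_tsupport _).trans tsupport_cutoffΘ_subset)

/-- `Ψ² ≤ Θ` (`Ψ ≤ 1`, and `Θ = 1` where `Ψ ≠ 0`). [folklore] -/
theorem cutoffΨ_sq_le_cutoffΘ (q : ℝ × ℝ) : cutoffΨ q ^ 2 ≤ cutoffΘ q := by
  by_cases h : cutoffΨ q = 0
  · rw [h, zero_pow two_ne_zero]
    exact cutoffΘ_nonneg q
  · rw [cutoffΘ_eq_one_of_mem_tsupport (subset_tsupport _ h)]
    have h0 := cutoffΨ_nonneg q
    have h1 := cutoffΨ_le_one q
    nlinarith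

/-- The uniform bound of the derivative of `Ψ` (a continuous compactly supported function).
[folklore] -/
def derivBoundΨ : ℝ := ⨆ q : ℝ × ℝ, ‖fderiv ℝ cutoffΨ q‖

/-- `‖DΨ(q)‖ ≤ derivBoundΨ`. [folklore] -/
theorem norm_fderiv_cutoffΨ_le (q : ℝ × ℝ) : ‖fderiv ℝ cutoffΨ q‖ ≤ derivBoundΨ := by
  have hc : Continuous fun p : ℝ × ℝ => ‖fderiv ℝ cutoffΨ p‖ :=
    ((contDiff_cutoffΨ (n := 1)).continuous_fderiv one_ne_zero).norm
  have hb : BddAbove (range fun p : ℝ × ℝ => ‖fderiv ℝ cutoffΨ p‖) :=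
    (hc.bddAbove_range_of_hasCompactSupport (hasCompactSupport_cutoffΨ.fderiv ℝ).norm)
  exact le_ciSup hb q

/-- `0 ≤ derivBoundΨ`. [folklore] -/
theorem derivBoundΨ_nonneg : 0 ≤ derivBoundΨ :=
  (norm_nonneg _).trans (norm_fderiv_cutoffΨ_le 0)

/-- **`|∇Ψ|² ≤ C² Θ`**: `(DΨ(q) v)² ≤ derivBoundΨ² ‖v‖² Θ(q)` (where `DΨ ≠ 0`, `Θ = 1`).
[folklore] -/
theorem fderiv_cutoffΨ_sq_le (q v : ℝ × ℝ) :
    (fderiv ℝ cutoffΨ q v) ^ 2 ≤ derivBoundΨ ^ 2 * ‖v‖ ^ 2 * cutoffΘ q := by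
  by_cases hq : q ∈ tsupport cutoffΨ
  · rw [cutoffΘ_eq_one_of_mem_tsupport hq, mul_one, ← mul_pow]
    have h := (fderiv ℝ cutoffΨ q).le_opNorm v
    have h' : ‖fderiv ℝ cutoffΨ q v‖ ≤ derivBoundΨ * ‖v‖ :=
      h.trans (mul_le_mul_of_nonneg_right (norm_fderiv_cutoffΨ_le q) (norm_nonneg _))
    rw [Real.norm_eq_abs] at h'
    exact (sq_abs _).symm.trans_le (pow_le_pow_left₀ (abs_nonneg _) h' 2)
  · have h0 : fderiv ℝ cutoffΨ q = 0 :=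
      image_eq_zero_of_notMem_tsupport fun h => hq (tsupport_fderiv_subset ℝ h)
    rw [h0, zero_apply, zero_pow two_ne_zero]
    have := cutoffΘ_nonneg q
    positivity

/-! ### The meridian profiles of the cut-off poloidal field -/

/-- Local notation for the intermediate shell `𝒞½ = 𝒞(9/32, 23/8; 15/8)`. -/
local notation "𝒞½" => shell (9 / 32 : ℝ) (23 / 8) (15 / 8)

/-- Local notation for the target shell `𝒞̃₁ = 𝒞(5/16, 11/4; 7/4)`. -/
local notation "𝒞₁" => shell (5 / 16 : ℝ) (11 / 4) (7 / 4)

/-- A Cartesian component of `u` read on the meridian half-plane: `q ↦ uᵢ(meridianPoint q)`.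
[folklore] -/
def profile (u : ℝ³ → ℝ³) (i : Fin 3) (q : ℝ × ℝ) : ℝ := u (meridianPoint q) i

/-- **The cut-off profiles** `Ψ · (uᵢ ∘ meridianPoint)`: for `i = 0` and `i = 2` these are the two
components `Ṽ_ϱ = V_ϱ ψ`, `Ṽ₃ = V₃ ψ` of the cut-off poloidal field `Ṽ = V^a ψ` of the proof of
Lemma 4.2, as functions of `(ϱ, x₃)`. [cite: SereginZajaczkowski2007, proof of Lemma 4.2 (Ṽ = V^aψ)] -/
def cutProfile (u : ℝ³ → ℝ³) (i : Fin 3) (q : ℝ × ℝ) : ℝ := cutoffΨ q * profile u i q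

/-- Unfolding `profile`. [folklore] -/
@[simp] theorem profile_apply (u : ℝ³ → ℝ³) (i : Fin 3) (q : ℝ × ℝ) :
    profile u i q = u (meridianPoint q) i := rfl

/-- Unfolding `cutProfile`. [folklore] -/
theorem cutProfile_apply (u : ℝ³ → ℝ³) (i : Fin 3) (q : ℝ × ℝ) :
    cutProfile u i q = cutoffΨ q * u (meridianPoint q) i := rfl

/-- Points of the open meridian section have `ϱ > 0` (indeed `ϱ > 9/32`). [folklore] -/
theorem fst_pos_of_mem_rectHalf {q : ℝ × ℝ} (hq : q ∈ rectHalf) : 0 < q.1 := by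
  have h : (9 / 32 : ℝ) < q.1 := hq.1.1
  linarith

/-- The meridian point of a point of the meridian section of `𝒞½` lies in `𝒞½`. [folklore] -/
theorem meridianPoint_mem_shellHalf {q : ℝ × ℝ} (hq : q ∈ rectHalf) : meridianPoint q ∈ 𝒞½ := by
  obtain ⟨⟨h1, h2⟩, h3, h4⟩ := hq
  rw [mem_shell, cylRadius_meridianPoint_eq_abs, meridianPoint_apply_two,
    abs_of_pos (fst_pos_of_mem_rectHalf ⟨⟨h1, h2⟩, h3, h4⟩)]
  exact ⟨⟨h1, h2⟩, abs_lt.2 ⟨h3, h4⟩⟩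

/-- `𝒞½` is invariant under the rotations about the axis. [folklore] -/
theorem rotZ_mem_shellHalf (θ : ℝ) (x : ℝ³) (hx : x ∈ 𝒞½) : rotZ θ x ∈ 𝒞½ :=
  (rotZ_mem_shell_iff θ).2 hx

section Profiles

variable {u : ℝ³ → ℝ³}

/-- The profiles are smooth on the meridian section of `𝒞½` when `u` is smooth on `𝒞½`.
[folklore] -/
theorem contDiffAt_profile (hs : ∀ x ∈ 𝒞½, ContDiffAt ℝ ∞ u x) {q : ℝ × ℝ} (hq : q ∈ rectHalf)
    (i : Fin 3) : ContDiffAt ℝ ∞ (profile u i) q :=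
  contDiffAt_apply_comp_meridianPoint (hs _ (meridianPoint_mem_shellHalf hq)) i

/-- **The cut-off profiles are smooth** on the whole plane. [folklore] -/
theorem contDiff_cutProfile (hs : ∀ x ∈ 𝒞½, ContDiffAt ℝ ∞ u x) (i : Fin 3) :
    ContDiff ℝ ∞ (cutProfile u i) :=
  contDiff_mul_of_tsupport_subset contDiff_cutoffΨ tsupport_cutoffΨ_subset_rectHalf
    fun _ hq => contDiffAt_profile hs hq i

/-- The cut-off profiles have compact support. [folklore] -/
theorem hasCompactSupport_cutProfile (u : ℝ³ → ℝ³) (i : Fin 3) :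
    HasCompactSupport (cutProfile u i) :=
  hasCompactSupport_cutoffΨ.mul_right

/-- The cut-off profiles vanish outside the support of `Ψ`. [folklore] -/
theorem cutProfile_eq_zero {q : ℝ × ℝ} (hq : q ∉ tsupport cutoffΨ) (i : Fin 3) :
    cutProfile u i q = 0 := by
  rw [cutProfile_apply, image_eq_zero_of_notMem_tsupport hq, zero_mul]

/-- **Derivatives of the cut-off profiles on the meridian section**: at `q ∈ rectHalf`,
`D(Ψ uᵢ)(q) v = DΨ(q) v · uᵢ(x) + Ψ(q) · (Du(x)(v₁ e₀ + v₂ e₂))ᵢ`, `x = meridianPoint q`. [folklore] -/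
theorem fderiv_cutProfile_apply (hs : ∀ x ∈ 𝒞½, ContDiffAt ℝ ∞ u x) {q : ℝ × ℝ}
    (hq : q ∈ rectHalf) (i : Fin 3) (v : ℝ × ℝ) :
    fderiv ℝ (cutProfile u i) q v =
      fderiv ℝ cutoffΨ q v * u (meridianPoint q) i + cutoffΨ q *
        fderiv ℝ u (meridianPoint q) (v.1 • EuclideanSpace.single (0 : Fin 3) (1 : ℝ) +
          v.2 • EuclideanSpace.single (2 : Fin 3) 1) i := by
  have hud : DifferentiableAt ℝ u (meridianPoint q) :=
    (hs _ (meridianPoint_mem_shellHalf hq)).differentiableAt (by simp)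
  have hΨd : DifferentiableAt ℝ cutoffΨ q := (contDiff_cutoffΨ (n := 1)).differentiable one_ne_zero q
  have hPd : DifferentiableAt ℝ (profile u i) q := (contDiffAt_profile hs hq i).differentiableAt (by simp)
  rw [show cutProfile u i = fun p => cutoffΨ p * profile u i p from rfl,
    fderiv_mul_apply_of_differentiableAt hΨd hPd, profile_apply,
    show profile u i = fun p => u (meridianPoint p) i from rfl, fderiv_apply_comp_meridianPoint hud]

/-- Outside the support of `Ψ` the derivatives of the cut-off profiles vanish. [folklore] -/
theorem fderiv_cutProfile_eq_zero {q : ℝ × ℝ} (hq : q ∉ tsupport cutoffΨ) (i : Fin 3)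
    (v : ℝ × ℝ) : fderiv ℝ (cutProfile u i) q v = 0 :=
  fderiv_mul_apply_of_notMem_tsupport hq v

/-- `(1, 0) ↦ e₀` under the derivative of the meridian embedding. [folklore] -/
theorem smul_single_fst :
    ((1 : ℝ), (0 : ℝ)).1 • EuclideanSpace.single (0 : Fin 3) (1 : ℝ) +
      ((1 : ℝ), (0 : ℝ)).2 • EuclideanSpace.single (2 : Fin 3) 1 = EuclideanSpace.single 0 1 := by
  simp

/-- `(0, 1) ↦ e₂` under the derivative of the meridian embedding. [folklore] -/
theorem smul_single_snd :
    ((0 : ℝ), (1 : ℝ)).1 • EuclideanSpace.single (0 : Fin 3) (1 : ℝ) +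
      ((0 : ℝ), (1 : ℝ)).2 • EuclideanSpace.single (2 : Fin 3) 1 = EuclideanSpace.single 2 1 := by
  simp

/-- **(4.6): the divergence of the cut-off poloidal profile field.** At `q ∈ rectHalf`,
`x = meridianPoint q`: `∂_ϱ(Ψu₀) + ∂_z(Ψu₂) = Ψ_ϱ u₀ + Ψ_z u₂ - Ψ u₀/ϱ`, for `u` smooth, axially
symmetric and divergence free on `𝒞½` ((4.3) `div u = ∂₀u₀ + u₀/ϱ + ∂₂u₂ = 0` at `x`).
[cite: SereginZajaczkowski2007, proof of Lemma 4.2, (4.6)] -/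
theorem div_cutProfile (hs : ∀ x ∈ 𝒞½, ContDiffAt ℝ ∞ u x)
    (ha : ∀ θ : ℝ, ∀ x ∈ 𝒞½, u (rotZ θ x) = rotZ θ (u x))
    (hd : ∀ x ∈ 𝒞½, VectorCalculus.divergence u x = 0) {q : ℝ × ℝ} (hq : q ∈ rectHalf) :
    fderiv ℝ (cutProfile u 0) q (1, 0) + fderiv ℝ (cutProfile u 2) q (0, 1) =
      fderiv ℝ cutoffΨ q (1, 0) * u (meridianPoint q) 0 +
        fderiv ℝ cutoffΨ q (0, 1) * u (meridianPoint q) 2 -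
          cutoffΨ q * (u (meridianPoint q) 0 / q.1) := by
  have hx := meridianPoint_mem_shellHalf hq
  have hud : DifferentiableAt ℝ u (meridianPoint q) := (hs _ hx).differentiableAt (by simp)
  have hJ := fderiv_rotGen_of_mem ha hx hud
  have hdiv := divergence_meridianPoint (fst_pos_of_mem_rectHalf hq) hJ
  rw [hd _ hx] at hdiv
  rw [fderiv_cutProfile_apply hs hq, fderiv_cutProfile_apply hs hq, smul_single_fst,
    smul_single_snd]
  linear_combination (-(cutoffΨ q)) * hdiv

/-- **(4.7): the curl of the cut-off poloidal profile field.** At `q ∈ rectHalf`,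
`x = meridianPoint q`: `∂_z(Ψu₀) - ∂_ϱ(Ψu₂) = Ψ_z u₀ - Ψ_ϱ u₂ + Ψ ω_φ(x)`, for `u` smooth on `𝒞½`
((4.4) `ω_φ = ∂₂u₀ - ∂₀u₂` at `x`). [cite: SereginZajaczkowski2007, proof of Lemma 4.2, (4.7)] -/
theorem curl_cutProfile (hs : ∀ x ∈ 𝒞½, ContDiffAt ℝ ∞ u x) {q : ℝ × ℝ} (hq : q ∈ rectHalf) :
    fderiv ℝ (cutProfile u 0) q (0, 1) - fderiv ℝ (cutProfile u 2) q (1, 0) =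
      fderiv ℝ cutoffΨ q (0, 1) * u (meridianPoint q) 0 -
        fderiv ℝ cutoffΨ q (1, 0) * u (meridianPoint q) 2 +
          cutoffΨ q * angularVorticity u (meridianPoint q) := by
  rw [fderiv_cutProfile_apply hs hq, fderiv_cutProfile_apply hs hq, smul_single_fst,
    smul_single_snd, angularVorticity_meridianPoint u (fst_pos_of_mem_rectHalf hq)]
  ring

/-- A Cartesian component is bounded by the norm: `uᵢ(x)² ≤ |u(x)|²`. [folklore] -/
theorem apply_sq_le_norm_sq (v : ℝ³) (i : Fin 3) : v i ^ 2 ≤ ‖v‖ ^ 2 := by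
  have h := PiLp.norm_apply_le v i
  rw [Real.norm_eq_abs] at h
  calc v i ^ 2 = |v i| ^ 2 := (sq_abs _).symm
    _ ≤ ‖v‖ ^ 2 := pow_le_pow_left₀ (abs_nonneg _) h 2

/-- The planar partial values of `DΨ` are bounded by `derivBoundΨ² Θ`. [folklore] -/
theorem fderiv_cutoffΨ_fst_sq_le (q : ℝ × ℝ) :
    (fderiv ℝ cutoffΨ q (1, 0)) ^ 2 ≤ derivBoundΨ ^ 2 * cutoffΘ q := by
  have h := fderiv_cutoffΨ_sq_le q (1, 0)
  have hn : ‖((1 : ℝ), (0 : ℝ))‖ = 1 := by simp [Prod.norm_def]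
  rwa [hn, one_pow, mul_one] at h

/-- The planar partial values of `DΨ` are bounded by `derivBoundΨ² Θ`. [folklore] -/
theorem fderiv_cutoffΨ_snd_sq_le (q : ℝ × ℝ) :
    (fderiv ℝ cutoffΨ q (0, 1)) ^ 2 ≤ derivBoundΨ ^ 2 * cutoffΘ q := by
  have h := fderiv_cutoffΨ_sq_le q (0, 1)
  have hn : ‖((0 : ℝ), (1 : ℝ))‖ = 1 := by simp [Prod.norm_def]
  rwa [hn, one_pow, mul_one] at h

/-- The constant of the pointwise bound of `div²`. [folklore] -/
def divConst : ℝ := 3 * (2 * derivBoundΨ ^ 2 + (32 / 9) ^ 2)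

/-- The constant of the pointwise bound of the velocity part of `curl²`. [folklore] -/
def curlConst : ℝ := 6 * derivBoundΨ ^ 2

/-- `0 ≤ divConst`. [folklore] -/
theorem divConst_nonneg : 0 ≤ divConst := by unfold divConst; positivity

/-- `0 ≤ curlConst`. [folklore] -/
theorem curlConst_nonneg : 0 ≤ curlConst := by unfold curlConst; positivity

/-- **Pointwise bound of `div²`**: `(∂_ϱ(Ψu₀) + ∂_z(Ψu₂))² ≤ divConst · Θ · |u ∘ meridianPoint|²`
everywhere (on the support of `Ψ` by (4.6), `Ψ² ≤ Θ`, `|∇Ψ|² ≤ C²Θ`, `1/ϱ ≤ 32/9`; elsewhere both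
derivatives vanish). [folklore] -/
theorem div_sq_le (hs : ∀ x ∈ 𝒞½, ContDiffAt ℝ ∞ u x)
    (ha : ∀ θ : ℝ, ∀ x ∈ 𝒞½, u (rotZ θ x) = rotZ θ (u x))
    (hd : ∀ x ∈ 𝒞½, VectorCalculus.divergence u x = 0) (q : ℝ × ℝ) :
    (fderiv ℝ (cutProfile u 0) q (1, 0) + fderiv ℝ (cutProfile u 2) q (0, 1)) ^ 2 ≤
      divConst * cutoffΘ q * ‖u (meridianPoint q)‖ ^ 2 := by
  have hΘ := cutoffΘ_nonneg q
  by_cases hq : q ∈ tsupport cutoffΨ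
  · have hqr : q ∈ rectHalf := tsupport_cutoffΨ_subset_rectHalf hq
    rw [div_cutProfile hs ha hd hqr]
    set x := meridianPoint q with hx
    set N := ‖u x‖ ^ 2 with hN
    have h0 : u x 0 ^ 2 ≤ N := apply_sq_le_norm_sq _ _
    have h2 : u x 2 ^ 2 ≤ N := apply_sq_le_norm_sq _ _
    have hA := fderiv_cutoffΨ_fst_sq_le q
    have hB := fderiv_cutoffΨ_snd_sq_le q
    have hΨ := cutoffΨ_sq_le_cutoffΘ q
    have hρ : (9 / 32 : ℝ) < q.1 := hqr.1.1
    have hρ0 : 0 < q.1 := by linarith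
    have hinv : (1 / q.1) ^ 2 ≤ (32 / 9 : ℝ) ^ 2 := by
      refine pow_le_pow_left₀ (by positivity) ?_ 2
      rw [div_le_iff₀ hρ0]
      nlinarith
    -- the three squares
    have e1 : (fderiv ℝ cutoffΨ q (1, 0) * u x 0) ^ 2 ≤ derivBoundΨ ^ 2 * cutoffΘ q * N := by
      rw [mul_pow]
      exact mul_le_mul hA h0 (sq_nonneg _) (by positivity)
    have e2 : (fderiv ℝ cutoffΨ q (0, 1) * u x 2) ^ 2 ≤ derivBoundΨ ^ 2 * cutoffΘ q * N := by
      rw [mul_pow]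
      exact mul_le_mul hB h2 (sq_nonneg _) (by positivity)
    have e3 : (cutoffΨ q * (u x 0 / q.1)) ^ 2 ≤ cutoffΘ q * ((32 / 9 : ℝ) ^ 2 * N) := by
      rw [mul_pow, show (u x 0 / q.1) ^ 2 = (1 / q.1) ^ 2 * u x 0 ^ 2 by ring]
      exact mul_le_mul hΨ (mul_le_mul hinv h0 (sq_nonneg _) (by positivity)) (by positivity) hΘ
    calc (fderiv ℝ cutoffΨ q (1, 0) * u x 0 + fderiv ℝ cutoffΨ q (0, 1) * u x 2 -
          cutoffΨ q * (u x 0 / q.1)) ^ 2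
        ≤ 3 * ((fderiv ℝ cutoffΨ q (1, 0) * u x 0) ^ 2 + (fderiv ℝ cutoffΨ q (0, 1) * u x 2) ^ 2 +
            (cutoffΨ q * (u x 0 / q.1)) ^ 2) := by
          nlinarith [sq_nonneg (fderiv ℝ cutoffΨ q (1, 0) * u x 0 - fderiv ℝ cutoffΨ q (0, 1) * u x 2),
            sq_nonneg (fderiv ℝ cutoffΨ q (1, 0) * u x 0 + cutoffΨ q * (u x 0 / q.1)),
            sq_nonneg (fderiv ℝ cutoffΨ q (0, 1) * u x 2 + cutoffΨ q * (u x 0 / q.1))]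
      _ ≤ 3 * (derivBoundΨ ^ 2 * cutoffΘ q * N + derivBoundΨ ^ 2 * cutoffΘ q * N +
            cutoffΘ q * ((32 / 9 : ℝ) ^ 2 * N)) := by gcongr
      _ = divConst * cutoffΘ q * N := by unfold divConst; ring
  · rw [fderiv_cutProfile_eq_zero hq, fderiv_cutProfile_eq_zero hq, add_zero, zero_pow two_ne_zero]
    have := divConst_nonneg
    positivity

/-- **Pointwise bound of `curl²`**:
`(∂_z(Ψu₀) - ∂_ϱ(Ψu₂))² ≤ curlConst · Θ · |u ∘ meridianPoint|² + 3 Ψ² ω_φ²` everywhere.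
[folklore] -/
theorem curl_sq_le (hs : ∀ x ∈ 𝒞½, ContDiffAt ℝ ∞ u x) (q : ℝ × ℝ) :
    (fderiv ℝ (cutProfile u 0) q (0, 1) - fderiv ℝ (cutProfile u 2) q (1, 0)) ^ 2 ≤
      curlConst * cutoffΘ q * ‖u (meridianPoint q)‖ ^ 2 +
        3 * (cutoffΨ q ^ 2 * angularVorticity u (meridianPoint q) ^ 2) := by
  have hΘ := cutoffΘ_nonneg q
  by_cases hq : q ∈ tsupport cutoffΨ
  · have hqr : q ∈ rectHalf := tsupport_cutoffΨ_subset_rectHalf hq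
    rw [curl_cutProfile hs hqr]
    set x := meridianPoint q with hx
    set N := ‖u x‖ ^ 2 with hN
    have h0 : u x 0 ^ 2 ≤ N := apply_sq_le_norm_sq _ _
    have h2 : u x 2 ^ 2 ≤ N := apply_sq_le_norm_sq _ _
    have hA := fderiv_cutoffΨ_fst_sq_le q
    have hB := fderiv_cutoffΨ_snd_sq_le q
    have e1 : (fderiv ℝ cutoffΨ q (0, 1) * u x 0) ^ 2 ≤ derivBoundΨ ^ 2 * cutoffΘ q * N := by
      rw [mul_pow]
      exact mul_le_mul hB h0 (sq_nonneg _) (by positivity)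
    have e2 : (fderiv ℝ cutoffΨ q (1, 0) * u x 2) ^ 2 ≤ derivBoundΨ ^ 2 * cutoffΘ q * N := by
      rw [mul_pow]
      exact mul_le_mul hA h2 (sq_nonneg _) (by positivity)
    calc (fderiv ℝ cutoffΨ q (0, 1) * u x 0 - fderiv ℝ cutoffΨ q (1, 0) * u x 2 +
          cutoffΨ q * angularVorticity u x) ^ 2
        ≤ 3 * ((fderiv ℝ cutoffΨ q (0, 1) * u x 0) ^ 2 + (fderiv ℝ cutoffΨ q (1, 0) * u x 2) ^ 2 +
            (cutoffΨ q * angularVorticity u x) ^ 2) := by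
          nlinarith [sq_nonneg (fderiv ℝ cutoffΨ q (0, 1) * u x 0 + fderiv ℝ cutoffΨ q (1, 0) * u x 2),
            sq_nonneg (fderiv ℝ cutoffΨ q (0, 1) * u x 0 - cutoffΨ q * angularVorticity u x),
            sq_nonneg (fderiv ℝ cutoffΨ q (1, 0) * u x 2 + cutoffΨ q * angularVorticity u x)]
      _ ≤ 3 * (derivBoundΨ ^ 2 * cutoffΘ q * N + derivBoundΨ ^ 2 * cutoffΘ q * N +
            (cutoffΨ q * angularVorticity u x) ^ 2) := by gcongr
      _ = curlConst * cutoffΘ q * N + 3 * (cutoffΨ q ^ 2 * angularVorticity u x ^ 2) := by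
          unfold curlConst; ring
  · rw [fderiv_cutProfile_eq_zero hq, fderiv_cutProfile_eq_zero hq, sub_zero, zero_pow two_ne_zero]
    have := curlConst_nonneg
    positivity

end Profiles

/-! ### Regularity of `u` on the shell and lifts of planar cut-offs to `ℝ³` -/

section Lifts

variable {u : ℝ³ → ℝ³}

/-- `u` is `C^∞` on the open shell. [folklore] -/
theorem contDiffOn_shellHalf (hs : ∀ x ∈ 𝒞½, ContDiffAt ℝ ∞ u x) : ContDiffOn ℝ ∞ u 𝒞½ :=
  fun x hx => (hs x hx).contDiffWithinAt

/-- `u` is continuous on the shell. [folklore] -/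
theorem continuousOn_shellHalf (hs : ∀ x ∈ 𝒞½, ContDiffAt ℝ ∞ u x) : ContinuousOn u 𝒞½ :=
  (contDiffOn_shellHalf hs).continuousOn

/-- `Du` is continuous on the shell. [folklore] -/
theorem continuousOn_fderiv_shellHalf (hs : ∀ x ∈ 𝒞½, ContDiffAt ℝ ∞ u x) :
    ContinuousOn (fun x => fderiv ℝ u x) 𝒞½ :=
  (contDiffOn_shellHalf hs).continuousOn_fderiv_of_isOpen (isOpen_shell _ _ _) (by simp)

/-- `u` is differentiable at the points of the shell. [folklore] -/
theorem differentiableAt_shellHalf (hs : ∀ x ∈ 𝒞½, ContDiffAt ℝ ∞ u x) {x : ℝ³} (hx : x ∈ 𝒞½) :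
    DifferentiableAt ℝ u x :=
  (hs x hx).differentiableAt (by simp)

/-- The angular unit vector field is continuous off the axis, in particular on the shell.
[folklore] -/
theorem continuousOn_eTheta_shellHalf : ContinuousOn eTheta 𝒞½ := by
  have h1 : ContinuousOn (fun x : ℝ³ => (cylRadius x)⁻¹) 𝒞½ :=
    continuous_cylRadius.continuousOn.inv₀ fun x hx => cylRadius_ne_zero_of_mem_shell (by norm_num) hx
  have h2 : Continuous fun x : ℝ³ => (toLp 2 ![-x 1, x 0, 0] : ℝ³) := by
    refine (PiLp.continuous_toLp 2 _).comp ?_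
    refine continuous_pi fun i => ?_
    fin_cases i
    · exact (PiLp.continuous_apply 2 _ 1).neg
    · exact PiLp.continuous_apply 2 _ 0
    · exact continuous_const
  exact h1.smul h2.continuousOn

/-- **The angular vorticity is continuous on the shell** (`u` is `C^∞` there). [folklore] -/
theorem continuousOn_angularVorticity (hs : ∀ x ∈ 𝒞½, ContDiffAt ℝ ∞ u x) :
    ContinuousOn (angularVorticity u) 𝒞½ := by
  have hc : ContinuousOn (fun x => curl u x) 𝒞½ := by
    have heq : (fun x => curl u x) = fun x => curlCLM (fderiv ℝ u x) := funext fun x => curl_eq_curlCLM u x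
    rw [heq]
    exact curlCLM.continuous.comp_continuousOn (continuousOn_fderiv_shellHalf hs)
  have heq : angularVorticity u = fun x => ⟪curl u x, eTheta x⟫ := funext fun x => rfl
  rw [heq]
  exact hc.inner continuousOn_eTheta_shellHalf

/-- The meridian projection is continuous. [folklore] -/
theorem continuous_meridian : Continuous meridian :=
  continuous_cylRadius.prodMk (PiLp.continuous_apply 2 _ 2)

/-- The meridian projection is invariant under the rotations about the axis. [folklore] -/
theorem meridian_rotZ (θ : ℝ) (x : ℝ³) : meridian (rotZ θ x) = meridian x := by
  rw [meridian_apply, meridian_apply, cylRadius_rotZ, rotZ_apply_two]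

/-- Points whose meridian coordinates lie in the support of `Θ` belong to the shell `𝒞½`.
[folklore] -/
theorem mem_shellHalf_of_meridian_mem {x : ℝ³} (hx : meridian x ∈ tsupport cutoffΘ) : x ∈ 𝒞½ := by
  obtain ⟨⟨h1, h2⟩, h3, h4⟩ := tsupport_cutoffΘ_subset hx
  rw [meridian_apply] at h1 h2 h3 h4
  dsimp only at h1 h2 h3 h4
  rw [mem_shell]
  exact ⟨⟨by linarith, by linarith⟩, abs_lt.2 ⟨by linarith, by linarith⟩⟩

/-- The support of `Ψ` lies in the support of `Θ`. [folklore] -/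
theorem tsupport_cutoffΨ_subset_tsupport_cutoffΘ : tsupport cutoffΨ ⊆ tsupport cutoffΘ := fun q hq =>
  subset_tsupport _ (by rw [mem_support, cutoffΘ_eq_one_of_mem_tsupport hq]; exact one_ne_zero)

/-- The support of `Ψ²` lies in the support of `Θ`. [folklore] -/
theorem tsupport_cutoffΨ_sq_subset :
    tsupport (fun q : ℝ × ℝ => cutoffΨ q ^ 2) ⊆ tsupport cutoffΘ := by
  rw [show (fun q : ℝ × ℝ => cutoffΨ q ^ 2) = fun q => cutoffΨ q * cutoffΨ q from
    funext fun q => sq _]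
  exact tsupport_mul_subset_left.trans tsupport_cutoffΨ_subset_tsupport_cutoffΘ

/-- `Ψ²` has compact support. [folklore] -/
theorem hasCompactSupport_cutoffΨ_sq : HasCompactSupport fun q : ℝ × ℝ => cutoffΨ q ^ 2 :=
  Calculus.hasCompactSupport_sq hasCompactSupport_cutoffΨ

/-- The set of points of `ℝ³` whose meridian coordinates lie in the support of `Θ` is compact
(closed, and `|x|² = ϱ² + x₃²` is bounded there). [folklore] -/
theorem isCompact_meridian_preimage : IsCompact (meridian ⁻¹' tsupport cutoffΘ) := by
  refine (isCompact_closedBall (0 : ℝ³) 4).of_isClosed_subset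
    ((isClosed_tsupport _).preimage continuous_meridian) fun x hx => ?_
  obtain ⟨⟨h1, h2⟩, h3, h4⟩ := tsupport_cutoffΘ_subset hx
  rw [meridian_apply] at h1 h2 h3 h4
  dsimp only at h1 h2 h3 h4
  rw [mem_closedBall, dist_zero_right]
  have hsq : ‖x‖ ^ 2 ≤ 4 ^ 2 := by
    rw [norm_sq_eq_cylRadius_sq_add]
    nlinarith [cylRadius_nonneg x, abs_le.2 ⟨h3, h4⟩, sq_abs (x 2), abs_nonneg (x 2)]
  exact (pow_le_pow_iff_left₀ (norm_nonneg x) (by norm_num) two_ne_zero).1 hsq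

variable {G : ℝ × ℝ → ℝ} {F : ℝ³ → ℝ}

/-- **Lifting a planar cut-off**: `x ↦ G(meridian x) · F(x)` is an axisymmetric scalar when `G`
is supported in the support of `Θ` and `F` is rotation invariant at the points of `𝒞½` (off `𝒞½`
the first factor vanishes). [folklore] -/
theorem isAxisymmetricScalar_lift (hG : tsupport G ⊆ tsupport cutoffΘ)
    (hF : ∀ θ : ℝ, ∀ x ∈ 𝒞½, F (rotZ θ x) = F x) :
    IsAxisymmetricScalar fun x => G (meridian x) * F x := by
  intro θ x
  dsimp only
  rw [meridian_rotZ]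
  by_cases hx : meridian x ∈ tsupport G
  · rw [hF θ x (mem_shellHalf_of_meridian_mem (hG hx))]
  · rw [image_eq_zero_of_notMem_tsupport hx, zero_mul, zero_mul]

/-- The lift is continuous when `G` is continuous and `F` is continuous on `𝒞½`. [folklore] -/
theorem continuous_lift (hGc : Continuous G) (hG : tsupport G ⊆ tsupport cutoffΘ)
    (hF : ContinuousOn F 𝒞½) : Continuous fun x => G (meridian x) * F x := by
  refine continuous_mul_of_tsupport_subset' (isOpen_shell _ _ _) (hGc.comp continuous_meridian) ?_ hF
  refine (closure_minimal ?_ ((isClosed_tsupport G).preimage continuous_meridian)).trans ?_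
  · intro x hx
    exact subset_tsupport _ hx
  · intro x hx
    exact mem_shellHalf_of_meridian_mem (hG hx)

/-- The lift has compact support. [folklore] -/
theorem hasCompactSupport_lift (hG : tsupport G ⊆ tsupport cutoffΘ) :
    HasCompactSupport fun x => G (meridian x) * F x := by
  refine HasCompactSupport.of_support_subset_isCompact isCompact_meridian_preimage fun x hx => ?_
  rw [mem_support] at hx
  exact hG (subset_tsupport _ (left_ne_zero_of_mul hx))

/-- On the support of the lift, `9/32 ≤ ϱ ≤ 23/8`. [folklore] -/
theorem cylRadius_mem_of_lift_ne_zero (hG : tsupport G ⊆ tsupport cutoffΘ) {x : ℝ³}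
    (hx : G (meridian x) * F x ≠ 0) : (9 / 32 : ℝ) ≤ cylRadius x ∧ cylRadius x ≤ 23 / 8 := by
  have h := mem_shellHalf_of_meridian_mem (hG (subset_tsupport _ (left_ne_zero_of_mul hx)))
  exact ⟨h.1.1.le, h.1.2.le⟩

end Lifts

/-! ### The planar integrals against the three-dimensional ones -/

/-- The constant `2/(c₂ · 9/32)` of the lower comparison `∫∫ X ∘ meridianPoint ≤ C ∫ X dx` on
`{ϱ ≥ 9/32}` (`c₂ = 2π`, accepted `radialConst₂`). [folklore] -/
def transferConst : ℝ := 2 / (radialConst₂ * (9 / 32))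

/-- `0 < transferConst`. [folklore] -/
theorem transferConst_pos : 0 < transferConst := by
  unfold transferConst
  have := radialConst₂_pos
  positivity

section Transfer

variable {u : ℝ³ → ℝ³}

/-- **The energy integral in the plane**: `∫∫ Θ |u ∘ meridianPoint|² ≤ C ∫_{ℝ³} Θ(ϱ, x₃) |u|² dx`
(`dx = ϱ dϱ dφ dx₃` with `ϱ ≥ 9/32`; the planar integrand vanishes for `ϱ ≤ 0`).
[cite: SereginZajaczkowski2007, proof of Lemma 4.2 (∫∫ |V^a|² dϱdx₃ ≤ c∫|V|²dx)] -/
theorem integral_cutoffΘ_mul_norm_sq_le (hs : ∀ x ∈ 𝒞½, ContDiffAt ℝ ∞ u x)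
    (ha : ∀ θ : ℝ, ∀ x ∈ 𝒞½, u (rotZ θ x) = rotZ θ (u x)) :
    ∫ q : ℝ × ℝ, cutoffΘ q * ‖u (meridianPoint q)‖ ^ 2 ≤
      transferConst * ∫ x, cutoffΘ (meridian x) * ‖u x‖ ^ 2 := by
  -- the lifted integrand
  have hF : ∀ θ : ℝ, ∀ x ∈ 𝒞½, ‖u (rotZ θ x)‖ ^ 2 = ‖u x‖ ^ 2 := fun θ x hx => by
    rw [ha θ x hx, norm_rotZ]
  have hXa := isAxisymmetricScalar_lift (F := fun x => ‖u x‖ ^ 2) subset_rfl hF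
  have hXc := continuous_lift (F := fun x => ‖u x‖ ^ 2) continuous_cutoffΘ subset_rfl
    ((continuousOn_shellHalf hs).norm.pow 2)
  have hXs := hasCompactSupport_lift (G := cutoffΘ) (F := fun x => ‖u x‖ ^ 2) subset_rfl
  have hX0 : ∀ x, 0 ≤ cutoffΘ (meridian x) * ‖u x‖ ^ 2 := fun x =>
    mul_nonneg (cutoffΘ_nonneg _) (sq_nonneg _)
  have hsupp : ∀ x, cutoffΘ (meridian x) * ‖u x‖ ^ 2 ≠ 0 → (9 / 32 : ℝ) ≤ cylRadius x :=
    fun x hx => (cylRadius_mem_of_lift_ne_zero (F := fun x => ‖u x‖ ^ 2) subset_rfl hx).1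
  have key := integral_profile_le_mul_integral (by norm_num : (0 : ℝ) < 9 / 32) hXa hXc hXs hX0 hsupp
  -- the planar integrand is dominated by the profile of the lift
  have hpt : ∀ q : ℝ × ℝ, cutoffΘ q * ‖u (meridianPoint q)‖ ^ 2 ≤
      cutoffΘ (meridian (meridianPoint q)) * ‖u (meridianPoint q)‖ ^ 2 := by
    intro q
    rcases le_or_gt 0 q.1 with hq | hq
    · rw [meridian_meridianPoint hq]
    · have h0 : cutoffΘ q = 0 := by
        by_contra h
        have := (mem_of_cutoffΘ_ne_zero h).1.1
        linarith
      rw [h0, zero_mul]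
      exact hX0 _
  -- integrability of the planar integrand
  have hmc : Continuous (meridianPoint : ℝ × ℝ → ℝ³) := (contDiff_meridianPoint (n := 0)).continuous
  have hPc : Continuous fun q : ℝ × ℝ => cutoffΘ q * ‖u (meridianPoint q)‖ ^ 2 := by
    refine continuous_mul_of_tsupport_subset' (X := ℝ × ℝ) ?_ continuous_cutoffΘ
      tsupport_cutoffΘ_subset_rectHalf ?_
    · exact (isOpen_Ioo.prod isOpen_Ioo)
    · exact ((continuousOn_shellHalf hs).comp hmc.continuousOn
        fun q hq => meridianPoint_mem_shellHalf hq).norm.pow 2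
  have hPi : Integrable fun q : ℝ × ℝ => cutoffΘ q * ‖u (meridianPoint q)‖ ^ 2 :=
    hPc.integrable_of_hasCompactSupport hasCompactSupport_cutoffΘ.mul_right
  have hLi : Integrable fun q : ℝ × ℝ => cutoffΘ (meridian (meridianPoint q)) * ‖u (meridianPoint q)‖ ^ 2 :=
    (hXc.comp hmc).integrable_of_hasCompactSupport (hasCompactSupport_comp_meridianPoint hXs)
  calc ∫ q : ℝ × ℝ, cutoffΘ q * ‖u (meridianPoint q)‖ ^ 2
      ≤ ∫ q : ℝ × ℝ, cutoffΘ (meridian (meridianPoint q)) * ‖u (meridianPoint q)‖ ^ 2 :=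
        integral_mono hPi hLi hpt
    _ ≤ 2 / (radialConst₂ * (9 / 32)) * ∫ x, cutoffΘ (meridian x) * ‖u x‖ ^ 2 := key
    _ = transferConst * ∫ x, cutoffΘ (meridian x) * ‖u x‖ ^ 2 := by rw [transferConst]

/-- **The lifted energy integral is at most `E`**: `∫ Θ(ϱ, x₃) |u|² dx ≤ ∫_{𝒞½} |u|² dx ≤ E`.
[folklore] -/
theorem integral_lift_norm_sq_le (hs : ∀ x ∈ 𝒞½, ContDiffAt ℝ ∞ u x) {E : ℝ≥0}
    (hE : ∫⁻ x in 𝒞½, ‖u x‖ₑ ^ 2 ≤ E) :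
    ∫ x, cutoffΘ (meridian x) * ‖u x‖ ^ 2 ≤ E := by
  have hXc := continuous_lift (F := fun x => ‖u x‖ ^ 2) continuous_cutoffΘ subset_rfl
    ((continuousOn_shellHalf hs).norm.pow 2)
  have hXs := hasCompactSupport_lift (G := cutoffΘ) (F := fun x => ‖u x‖ ^ 2) subset_rfl
  have hX0 : ∀ x, 0 ≤ cutoffΘ (meridian x) * ‖u x‖ ^ 2 := fun x =>
    mul_nonneg (cutoffΘ_nonneg _) (sq_nonneg _)
  have hXi : Integrable fun x => cutoffΘ (meridian x) * ‖u x‖ ^ 2 :=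
    hXc.integrable_of_hasCompactSupport hXs
  -- support in the shell
  have hsupp : support (fun x => ENNReal.ofReal (cutoffΘ (meridian x) * ‖u x‖ ^ 2)) ⊆ 𝒞½ := by
    intro x hx
    rw [mem_support, ne_eq, ENNReal.ofReal_eq_zero, not_le] at hx
    exact mem_shellHalf_of_meridian_mem (subset_tsupport _ (left_ne_zero_of_mul hx.ne'))
  have h1 : ENNReal.ofReal (∫ x, cutoffΘ (meridian x) * ‖u x‖ ^ 2) ≤ (E : ℝ≥0∞) := by
    rw [← lintegral_ofReal_eq_ofReal_integral hXi hX0, ← setLIntegral_eq_of_support_subset hsupp]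
    refine le_trans (setLIntegral_mono' (isOpen_shell _ _ _).measurableSet fun x _ => ?_) hE
    rw [← ofReal_norm, ← ENNReal.ofReal_pow (norm_nonneg _)]
    refine ENNReal.ofReal_le_ofReal ?_
    have h1 := cutoffΘ_le_one (meridian x)
    have h2 := sq_nonneg ‖u x‖
    nlinarith
  rw [← ENNReal.ofReal_coe_nnreal] at h1
  exact (ENNReal.ofReal_le_ofReal_iff (NNReal.coe_nonneg E)).1 h1

/-- **The vorticity integral in the plane**:
`∫∫ Ψ² ω_φ² ∘ meridianPoint ≤ C ∫_{ℝ³} Ψ(ϱ, x₃)² ω_φ² dx`. [cite: SereginZajaczkowski2007, proof of Lemma 4.2 (∫∫ |χ̃|² dϱdx₃)] -/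
theorem integral_cutoffΨ_sq_mul_angularVorticity_sq_le (hs : ∀ x ∈ 𝒞½, ContDiffAt ℝ ∞ u x)
    (ha : ∀ θ : ℝ, ∀ x ∈ 𝒞½, u (rotZ θ x) = rotZ θ (u x)) :
    ∫ q : ℝ × ℝ, cutoffΨ q ^ 2 * angularVorticity u (meridianPoint q) ^ 2 ≤
      transferConst * ∫ x, cutoffΨ (meridian x) ^ 2 * angularVorticity u x ^ 2 := by
  have hGs := tsupport_cutoffΨ_sq_subset
  have hF : ∀ θ : ℝ, ∀ x ∈ 𝒞½, angularVorticity u (rotZ θ x) ^ 2 = angularVorticity u x ^ 2 :=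
    fun θ x hx => by
    rw [angularVorticity_rotZ_of_mem (isOpen_shell _ _ _) rotZ_mem_shellHalf ha
      (fun y hy => differentiableAt_shellHalf hs hy) θ hx]
  have hXa := isAxisymmetricScalar_lift (F := fun x => angularVorticity u x ^ 2) hGs hF
  have hXc := continuous_lift (F := fun x => angularVorticity u x ^ 2)
    (continuous_cutoffΨ.pow 2) hGs ((continuousOn_angularVorticity hs).pow 2)
  have hXs := hasCompactSupport_lift (G := fun q => cutoffΨ q ^ 2)
    (F := fun x => angularVorticity u x ^ 2) hGs
  have hX0 : ∀ x, 0 ≤ cutoffΨ (meridian x) ^ 2 * angularVorticity u x ^ 2 := fun x => by positivity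
  have hsupp : ∀ x, cutoffΨ (meridian x) ^ 2 * angularVorticity u x ^ 2 ≠ 0 →
      (9 / 32 : ℝ) ≤ cylRadius x := fun x hx =>
    (cylRadius_mem_of_lift_ne_zero (F := fun x => angularVorticity u x ^ 2) hGs hx).1
  have key := integral_profile_le_mul_integral (by norm_num : (0 : ℝ) < 9 / 32) hXa hXc hXs hX0 hsupp
  have hpt : ∀ q : ℝ × ℝ, cutoffΨ q ^ 2 * angularVorticity u (meridianPoint q) ^ 2 ≤
      cutoffΨ (meridian (meridianPoint q)) ^ 2 * angularVorticity u (meridianPoint q) ^ 2 := by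
    intro q
    rcases le_or_gt 0 q.1 with hq | hq
    · rw [meridian_meridianPoint hq]
    · have h0 : cutoffΨ q = 0 := by
        by_contra h
        have := (mem_of_cutoffΨ_ne_zero h).1.1
        linarith
      rw [h0, zero_pow two_ne_zero, zero_mul]
      exact hX0 _
  have hmc : Continuous (meridianPoint : ℝ × ℝ → ℝ³) := (contDiff_meridianPoint (n := 0)).continuous
  have hPc : Continuous fun q : ℝ × ℝ => cutoffΨ q ^ 2 * angularVorticity u (meridianPoint q) ^ 2 := by
    refine continuous_mul_of_tsupport_subset' (X := ℝ × ℝ) (isOpen_Ioo.prod isOpen_Ioo)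
      (continuous_cutoffΨ.pow 2) (hGs.trans tsupport_cutoffΘ_subset_rectHalf) ?_
    exact ((continuousOn_angularVorticity hs).comp hmc.continuousOn
      fun q hq => meridianPoint_mem_shellHalf hq).pow 2
  have hPi : Integrable fun q : ℝ × ℝ => cutoffΨ q ^ 2 * angularVorticity u (meridianPoint q) ^ 2 :=
    hPc.integrable_of_hasCompactSupport hasCompactSupport_cutoffΨ_sq.mul_right
  have hLi : Integrable fun q : ℝ × ℝ =>
      cutoffΨ (meridian (meridianPoint q)) ^ 2 * angularVorticity u (meridianPoint q) ^ 2 :=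
    (hXc.comp hmc).integrable_of_hasCompactSupport (hasCompactSupport_comp_meridianPoint hXs)
  calc ∫ q : ℝ × ℝ, cutoffΨ q ^ 2 * angularVorticity u (meridianPoint q) ^ 2
      ≤ ∫ q : ℝ × ℝ, cutoffΨ (meridian (meridianPoint q)) ^ 2 * angularVorticity u (meridianPoint q) ^ 2 :=
        integral_mono hPi hLi hpt
    _ ≤ 2 / (radialConst₂ * (9 / 32)) * ∫ x, cutoffΨ (meridian x) ^ 2 * angularVorticity u x ^ 2 := key
    _ = transferConst * ∫ x, cutoffΨ (meridian x) ^ 2 * angularVorticity u x ^ 2 := by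
        rw [transferConst]

/-- **The lifted vorticity integral is at most `M`**: `∫ Ψ(ϱ,x₃)² ω_φ² dx ≤ ∫_{𝒞½} ω_φ² dx ≤ M`.
[folklore] -/
theorem integral_lift_angularVorticity_sq_le (hs : ∀ x ∈ 𝒞½, ContDiffAt ℝ ∞ u x) {M : ℝ≥0}
    (hM : ∫⁻ x in 𝒞½, ‖angularVorticity u x‖ₑ ^ 2 ≤ M) :
    ∫ x, cutoffΨ (meridian x) ^ 2 * angularVorticity u x ^ 2 ≤ M := by
  have hGs := tsupport_cutoffΨ_sq_subset
  have hXc := continuous_lift (F := fun x => angularVorticity u x ^ 2)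
    (continuous_cutoffΨ.pow 2) hGs ((continuousOn_angularVorticity hs).pow 2)
  have hXs := hasCompactSupport_lift (G := fun q => cutoffΨ q ^ 2)
    (F := fun x => angularVorticity u x ^ 2) hGs
  have hX0 : ∀ x, 0 ≤ cutoffΨ (meridian x) ^ 2 * angularVorticity u x ^ 2 := fun x => by positivity
  have hXi : Integrable fun x => cutoffΨ (meridian x) ^ 2 * angularVorticity u x ^ 2 :=
    hXc.integrable_of_hasCompactSupport hXs
  have hsupp : support (fun x => ENNReal.ofReal (cutoffΨ (meridian x) ^ 2 * angularVorticity u x ^ 2)) ⊆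
      𝒞½ := by
    intro x hx
    rw [mem_support, ne_eq, ENNReal.ofReal_eq_zero, not_le] at hx
    exact mem_shellHalf_of_meridian_mem (hGs (subset_tsupport _ (left_ne_zero_of_mul hx.ne')))
  have h1 : ENNReal.ofReal (∫ x, cutoffΨ (meridian x) ^ 2 * angularVorticity u x ^ 2) ≤ (M : ℝ≥0∞) := by
    rw [← lintegral_ofReal_eq_ofReal_integral hXi hX0, ← setLIntegral_eq_of_support_subset hsupp]
    refine le_trans (setLIntegral_mono' (isOpen_shell _ _ _).measurableSet fun x _ => ?_) hM
    rw [Real.enorm_eq_ofReal_abs, ← ENNReal.ofReal_pow (abs_nonneg _), sq_abs]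
    refine ENNReal.ofReal_le_ofReal ?_
    have h1 := cutoffΨ_le_one (meridian x)
    have h0 := cutoffΨ_nonneg (meridian x)
    have h2 := sq_nonneg (angularVorticity u x)
    nlinarith [mul_le_one₀ h1 h0 h1]
  rw [← ENNReal.ofReal_coe_nnreal] at h1
  exact (ENNReal.ofReal_le_ofReal_iff (NNReal.coe_nonneg M)).1 h1

end Transfer

/-! ### The planar Dirichlet integral of the cut-off profiles -/

section Dirichlet

variable {u : ℝ³ → ℝ³}

/-- A directional derivative of a cut-off profile is continuous. [folklore] -/
theorem continuous_fderiv_cutProfile (hs : ∀ x ∈ 𝒞½, ContDiffAt ℝ ∞ u x) (i : Fin 3) (v : ℝ × ℝ) :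
    Continuous fun q => fderiv ℝ (cutProfile u i) q v :=
  ((contDiff_cutProfile hs i).continuous_fderiv (by simp)).clm_apply continuous_const

/-- A directional derivative of a cut-off profile has compact support. [folklore] -/
theorem hasCompactSupport_fderiv_cutProfile (u : ℝ³ → ℝ³) (i : Fin 3) (v : ℝ × ℝ) :
    HasCompactSupport fun q => fderiv ℝ (cutProfile u i) q v :=
  (hasCompactSupport_cutProfile u i).fderiv_apply (𝕜 := ℝ) v

/-- The square of a directional derivative of a cut-off profile is integrable. [folklore] -/
theorem integrable_fderiv_cutProfile_sq (hs : ∀ x ∈ 𝒞½, ContDiffAt ℝ ∞ u x) (i : Fin 3)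
    (v : ℝ × ℝ) : Integrable fun q => (fderiv ℝ (cutProfile u i) q v) ^ 2 :=
  ((continuous_fderiv_cutProfile hs i v).pow 2).integrable_of_hasCompactSupport
    (Calculus.hasCompactSupport_sq (hasCompactSupport_fderiv_cutProfile u i v))

/-- **The `div`–`curl` identity for the cut-off profiles**:
`∫∫ (|∇a|² + |∇b|²) = ∫∫ ((∂_ϱa + ∂_zb)² + (∂_za - ∂_ϱb)²)`, `a = Ψu₀`, `b = Ψu₂`
(accepted `Calculus.integral_div_sq_add_curl_sq`). [folklore] -/
theorem integral_grad_sq_eq (hs : ∀ x ∈ 𝒞½, ContDiffAt ℝ ∞ u x) :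
    ∫ q : ℝ × ℝ, ((fderiv ℝ (cutProfile u 0) q (1, 0)) ^ 2 + (fderiv ℝ (cutProfile u 0) q (0, 1)) ^ 2 +
        (fderiv ℝ (cutProfile u 2) q (1, 0)) ^ 2 + (fderiv ℝ (cutProfile u 2) q (0, 1)) ^ 2) =
      ∫ q : ℝ × ℝ, ((fderiv ℝ (cutProfile u 0) q (1, 0) + fderiv ℝ (cutProfile u 2) q (0, 1)) ^ 2 +
        (fderiv ℝ (cutProfile u 0) q (0, 1) - fderiv ℝ (cutProfile u 2) q (1, 0)) ^ 2) := by
  have h1 : ContDiff ℝ 1 (cutProfile u 0) :=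
    (contDiff_cutProfile hs 0).of_le (by exact_mod_cast (le_top : (1 : ℕ∞) ≤ ⊤))
  have h2 : ContDiff ℝ 2 (cutProfile u 2) :=
    (contDiff_cutProfile hs 2).of_le (by
      change ((2 : ℕ∞) : WithTop ℕ∞) ≤ ((⊤ : ℕ∞) : WithTop ℕ∞)
      exact WithTop.coe_le_coe.mpr le_top)
  exact (Calculus.integral_div_sq_add_curl_sq (μ := volume) h1 h2 (hasCompactSupport_cutProfile u 0)
    (hasCompactSupport_cutProfile u 2) (1, 0) (0, 1)).symm

/-- The planar energy integrand `Θ |u ∘ meridianPoint|²` is integrable. [folklore] -/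
theorem integrable_cutoffΘ_mul_norm_sq (hs : ∀ x ∈ 𝒞½, ContDiffAt ℝ ∞ u x) :
    Integrable fun q : ℝ × ℝ => cutoffΘ q * ‖u (meridianPoint q)‖ ^ 2 := by
  have hmc : Continuous (meridianPoint : ℝ × ℝ → ℝ³) := (contDiff_meridianPoint (n := 0)).continuous
  have hPc : Continuous fun q : ℝ × ℝ => cutoffΘ q * ‖u (meridianPoint q)‖ ^ 2 := by
    refine continuous_mul_of_tsupport_subset' (X := ℝ × ℝ) (isOpen_Ioo.prod isOpen_Ioo)
      continuous_cutoffΘ tsupport_cutoffΘ_subset_rectHalf ?_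
    exact ((continuousOn_shellHalf hs).comp hmc.continuousOn
      fun q hq => meridianPoint_mem_shellHalf hq).norm.pow 2
  exact hPc.integrable_of_hasCompactSupport hasCompactSupport_cutoffΘ.mul_right

/-- The planar vorticity integrand `Ψ² ω_φ² ∘ meridianPoint` is integrable. [folklore] -/
theorem integrable_cutoffΨ_sq_mul_angularVorticity_sq (hs : ∀ x ∈ 𝒞½, ContDiffAt ℝ ∞ u x) :
    Integrable fun q : ℝ × ℝ => cutoffΨ q ^ 2 * angularVorticity u (meridianPoint q) ^ 2 := by
  have hmc : Continuous (meridianPoint : ℝ × ℝ → ℝ³) := (contDiff_meridianPoint (n := 0)).continuous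
  have hPc : Continuous fun q : ℝ × ℝ => cutoffΨ q ^ 2 * angularVorticity u (meridianPoint q) ^ 2 := by
    refine continuous_mul_of_tsupport_subset' (X := ℝ × ℝ) (isOpen_Ioo.prod isOpen_Ioo)
      (continuous_cutoffΨ.pow 2) (tsupport_cutoffΨ_sq_subset.trans tsupport_cutoffΘ_subset_rectHalf) ?_
    exact ((continuousOn_angularVorticity hs).comp hmc.continuousOn
      fun q hq => meridianPoint_mem_shellHalf hq).pow 2
  exact hPc.integrable_of_hasCompactSupport hasCompactSupport_cutoffΨ_sq.mul_right

/-- **"`∫∫ |∇_a Ṽ|² dϱ dx₃ ≤ c ∫∫ (|χ̃|² + |V^a|²) dϱ dx₃`"**: the planar Dirichlet integral of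
the cut-off profiles is bounded by the planar energy and vorticity integrals,
`∫∫ (|∇a|² + |∇b|²) ≤ (divConst + curlConst) ∫∫ Θ|u|² + 3 ∫∫ Ψ² ω_φ²`.
[cite: SereginZajaczkowski2007, proof of Lemma 4.2 ("According to (4.6) and (4.7), one may conclude")] -/
theorem integral_grad_sq_le (hs : ∀ x ∈ 𝒞½, ContDiffAt ℝ ∞ u x)
    (ha : ∀ θ : ℝ, ∀ x ∈ 𝒞½, u (rotZ θ x) = rotZ θ (u x))
    (hd : ∀ x ∈ 𝒞½, VectorCalculus.divergence u x = 0) :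
    ∫ q : ℝ × ℝ, ((fderiv ℝ (cutProfile u 0) q (1, 0)) ^ 2 + (fderiv ℝ (cutProfile u 0) q (0, 1)) ^ 2 +
        (fderiv ℝ (cutProfile u 2) q (1, 0)) ^ 2 + (fderiv ℝ (cutProfile u 2) q (0, 1)) ^ 2) ≤
      (divConst + curlConst) * (∫ q : ℝ × ℝ, cutoffΘ q * ‖u (meridianPoint q)‖ ^ 2) +
        3 * (∫ q : ℝ × ℝ, cutoffΨ q ^ 2 * angularVorticity u (meridianPoint q) ^ 2) := by
  rw [integral_grad_sq_eq hs]
  have iE := integrable_cutoffΘ_mul_norm_sq hs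
  have iM := integrable_cutoffΨ_sq_mul_angularVorticity_sq hs
  have iD : Integrable fun q : ℝ × ℝ =>
      (fderiv ℝ (cutProfile u 0) q (1, 0) + fderiv ℝ (cutProfile u 2) q (0, 1)) ^ 2 +
        (fderiv ℝ (cutProfile u 0) q (0, 1) - fderiv ℝ (cutProfile u 2) q (1, 0)) ^ 2 := by
    refine Integrable.add ?_ ?_
    · exact (((continuous_fderiv_cutProfile hs 0 (1, 0)).add
        (continuous_fderiv_cutProfile hs 2 (0, 1))).pow 2).integrable_of_hasCompactSupport
        (Calculus.hasCompactSupport_sq ((hasCompactSupport_fderiv_cutProfile u 0 (1, 0)).add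
          (hasCompactSupport_fderiv_cutProfile u 2 (0, 1))))
    · exact (((continuous_fderiv_cutProfile hs 0 (0, 1)).sub
        (continuous_fderiv_cutProfile hs 2 (1, 0))).pow 2).integrable_of_hasCompactSupport
        (Calculus.hasCompactSupport_sq ((hasCompactSupport_fderiv_cutProfile u 0 (0, 1)).sub
          (hasCompactSupport_fderiv_cutProfile u 2 (1, 0))))
  have iR : Integrable fun q : ℝ × ℝ => (divConst + curlConst) * (cutoffΘ q * ‖u (meridianPoint q)‖ ^ 2) +
      3 * (cutoffΨ q ^ 2 * angularVorticity u (meridianPoint q) ^ 2) :=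
    (iE.const_mul _).add (iM.const_mul _)
  calc _ ≤ ∫ q : ℝ × ℝ, ((divConst + curlConst) * (cutoffΘ q * ‖u (meridianPoint q)‖ ^ 2) +
          3 * (cutoffΨ q ^ 2 * angularVorticity u (meridianPoint q) ^ 2)) := by
        refine integral_mono iD iR fun q => ?_
        have h1 := div_sq_le hs ha hd q
        have h2 := curl_sq_le hs q
        dsimp only
        nlinarith [h1, h2]
    _ = (divConst + curlConst) * (∫ q : ℝ × ℝ, cutoffΘ q * ‖u (meridianPoint q)‖ ^ 2) +
          3 * (∫ q : ℝ × ℝ, cutoffΨ q ^ 2 * angularVorticity u (meridianPoint q) ^ 2) := by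
        rw [integral_add (iE.const_mul _) (iM.const_mul _), integral_const_mul, integral_const_mul]

/-- **Gradient of one profile against the Dirichlet integral**: by `‖L‖² ≤ 2 (L(1,0)² + L(0,1)²)`,
`∫∫ ‖D(Ψuᵢ)‖² ≤ 2 ∫∫ (|∇a|² + |∇b|²)` for `i = 0, 2`. [folklore] -/
theorem integral_norm_fderiv_sq_le (hs : ∀ x ∈ 𝒞½, ContDiffAt ℝ ∞ u x) {i : Fin 3}
    (hi : i = 0 ∨ i = 2) :
    ∫ q : ℝ × ℝ, ‖fderiv ℝ (cutProfile u i) q‖ ^ 2 ≤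
      2 * ∫ q : ℝ × ℝ, ((fderiv ℝ (cutProfile u 0) q (1, 0)) ^ 2 + (fderiv ℝ (cutProfile u 0) q (0, 1)) ^ 2 +
        (fderiv ℝ (cutProfile u 2) q (1, 0)) ^ 2 + (fderiv ℝ (cutProfile u 2) q (0, 1)) ^ 2) := by
  have iS : Integrable fun q : ℝ × ℝ => (fderiv ℝ (cutProfile u 0) q (1, 0)) ^ 2 +
      (fderiv ℝ (cutProfile u 0) q (0, 1)) ^ 2 + (fderiv ℝ (cutProfile u 2) q (1, 0)) ^ 2 +
      (fderiv ℝ (cutProfile u 2) q (0, 1)) ^ 2 :=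
    (((integrable_fderiv_cutProfile_sq hs 0 (1, 0)).add (integrable_fderiv_cutProfile_sq hs 0 (0, 1))).add
      (integrable_fderiv_cutProfile_sq hs 2 (1, 0))).add (integrable_fderiv_cutProfile_sq hs 2 (0, 1))
  have iN : Integrable fun q : ℝ × ℝ => ‖fderiv ℝ (cutProfile u i) q‖ ^ 2 :=
    (((contDiff_cutProfile hs i).continuous_fderiv (by simp)).norm.pow 2).integrable_of_hasCompactSupport
      (Calculus.hasCompactSupport_sq ((hasCompactSupport_cutProfile u i).fderiv ℝ).norm)
  rw [← integral_const_mul]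
  refine integral_mono iN (iS.const_mul 2) fun q => ?_
  dsimp only
  have h := norm_sq_le_two_mul (fderiv ℝ (cutProfile u i) q)
  rcases hi with rfl | rfl
  · nlinarith [sq_nonneg (fderiv ℝ (cutProfile u 2) q (1, 0)), sq_nonneg (fderiv ℝ (cutProfile u 2) q (0, 1))]
  · nlinarith [sq_nonneg (fderiv ℝ (cutProfile u 0) q (1, 0)), sq_nonneg (fderiv ℝ (cutProfile u 0) q (0, 1))]

/-- **`L²` norm of one profile against the planar energy**: `∫∫ (Ψuᵢ)² ≤ ∫∫ Θ |u|²`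
(`Ψ² ≤ Θ`, `uᵢ² ≤ |u|²`). [folklore] -/
theorem integral_cutProfile_sq_le (hs : ∀ x ∈ 𝒞½, ContDiffAt ℝ ∞ u x) (i : Fin 3) :
    ∫ q : ℝ × ℝ, cutProfile u i q ^ 2 ≤ ∫ q : ℝ × ℝ, cutoffΘ q * ‖u (meridianPoint q)‖ ^ 2 := by
  have iA : Integrable fun q : ℝ × ℝ => cutProfile u i q ^ 2 :=
    ((contDiff_cutProfile hs i).continuous.pow 2).integrable_of_hasCompactSupport
      (Calculus.hasCompactSupport_sq (hasCompactSupport_cutProfile u i))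
  refine integral_mono iA (integrable_cutoffΘ_mul_norm_sq hs) fun q => ?_
  dsimp only
  rw [cutProfile_apply, mul_pow]
  exact mul_le_mul (cutoffΨ_sq_le_cutoffΘ q) (apply_sq_le_norm_sq _ _) (sq_nonneg _) (cutoffΘ_nonneg q)

end Dirichlet

/-! ### The planar moments of the profiles -/

/-- The constant `K_m` of the planar even-moment inequality
`∫∫ g^{2m} ≤ K_m (∫∫ g²)(∫∫ ‖Dg‖²)^{m-1}` (accepted `exists_planar_even_moment_const`), for
`m ≥ 1`; `0` for `m = 0` (unused). [folklore] -/
def momentConst (m : ℕ) : ℝ :=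
  if h : 1 ≤ m then Classical.choose (exists_planar_even_moment_const m h) else 0

/-- `0 ≤ K_m`. [folklore] -/
theorem momentConst_nonneg (m : ℕ) : 0 ≤ momentConst m := by
  unfold momentConst
  split_ifs with h
  · exact (Classical.choose_spec (exists_planar_even_moment_const m h)).1
  · exact le_rfl

/-- The defining inequality of `K_m`. [folklore] -/
theorem integral_pow_le_momentConst {m : ℕ} (hm : 1 ≤ m) {g : ℝ × ℝ → ℝ} (hg : ContDiff ℝ 1 g)
    (hgc : HasCompactSupport g) :
    ∫ q, g q ^ (2 * m) ≤ momentConst m * (∫ q, g q ^ 2) * (∫ q, ‖fderiv ℝ g q‖ ^ 2) ^ (m - 1) := by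
  have h := (Classical.choose_spec (exists_planar_even_moment_const m hm)).2 g hg hgc
  unfold momentConst
  rw [dif_pos hm]
  exact h

/-- **The bound of the planar Dirichlet integral in terms of `(M, E)`**:
`DB(M, E) = (divConst + curlConst) · C_T E + 3 C_T M`, `C_T = transferConst`. [folklore] -/
def dirichletBound (M E : ℝ) : ℝ := (divConst + curlConst) * (transferConst * E) + 3 * (transferConst * M)

/-- `DB` is non-negative on non-negative arguments. [folklore] -/
theorem dirichletBound_nonneg {M E : ℝ} (hM : 0 ≤ M) (hE : 0 ≤ E) : 0 ≤ dirichletBound M E := by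
  unfold dirichletBound
  have := divConst_nonneg; have := curlConst_nonneg; have := transferConst_pos.le
  positivity

/-- `DB` is non-decreasing in each variable. [folklore] -/
theorem dirichletBound_mono {M M' E E' : ℝ} (hM : M ≤ M') (hE : E ≤ E') :
    dirichletBound M E ≤ dirichletBound M' E' := by
  unfold dirichletBound
  have := divConst_nonneg; have := curlConst_nonneg; have := transferConst_pos.le
  gcongr

section Moments

variable {u : ℝ³ → ℝ³}

/-- **The Dirichlet integral is at most `DB(M, E)`.**
[cite: SereginZajaczkowski2007, proof of Lemma 4.2 ("∫∫|∇_aṼ|² ≤ … ≤ Φ₃(𝒜₂)")] -/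
theorem integral_grad_sq_le_dirichletBound (hs : ∀ x ∈ 𝒞½, ContDiffAt ℝ ∞ u x)
    (ha : ∀ θ : ℝ, ∀ x ∈ 𝒞½, u (rotZ θ x) = rotZ θ (u x))
    (hd : ∀ x ∈ 𝒞½, VectorCalculus.divergence u x = 0) {M E : ℝ≥0}
    (hM : ∫⁻ x in 𝒞½, ‖angularVorticity u x‖ₑ ^ 2 ≤ M) (hE : ∫⁻ x in 𝒞½, ‖u x‖ₑ ^ 2 ≤ E) :
    ∫ q : ℝ × ℝ, ((fderiv ℝ (cutProfile u 0) q (1, 0)) ^ 2 + (fderiv ℝ (cutProfile u 0) q (0, 1)) ^ 2 +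
        (fderiv ℝ (cutProfile u 2) q (1, 0)) ^ 2 + (fderiv ℝ (cutProfile u 2) q (0, 1)) ^ 2) ≤
      dirichletBound M E := by
  have h1 := integral_grad_sq_le hs ha hd
  have h2 := (integral_cutoffΘ_mul_norm_sq_le hs ha).trans
    (mul_le_mul_of_nonneg_left (integral_lift_norm_sq_le hs hE) transferConst_pos.le)
  have h3 := (integral_cutoffΨ_sq_mul_angularVorticity_sq_le hs ha).trans
    (mul_le_mul_of_nonneg_left (integral_lift_angularVorticity_sq_le hs hM) transferConst_pos.le)
  have hc : 0 ≤ divConst + curlConst := add_nonneg divConst_nonneg curlConst_nonneg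
  unfold dirichletBound
  nlinarith [mul_le_mul_of_nonneg_left h2 hc, h3]

/-- **`∫∫ (Ψuᵢ)² ≤ C_T E`.** [folklore] -/
theorem integral_cutProfile_sq_le_energy (hs : ∀ x ∈ 𝒞½, ContDiffAt ℝ ∞ u x)
    (ha : ∀ θ : ℝ, ∀ x ∈ 𝒞½, u (rotZ θ x) = rotZ θ (u x)) {E : ℝ≥0}
    (hE : ∫⁻ x in 𝒞½, ‖u x‖ₑ ^ 2 ≤ E) (i : Fin 3) :
    ∫ q : ℝ × ℝ, cutProfile u i q ^ 2 ≤ transferConst * E :=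
  (integral_cutProfile_sq_le hs i).trans ((integral_cutoffΘ_mul_norm_sq_le hs ha).trans
    (mul_le_mul_of_nonneg_left (integral_lift_norm_sq_le hs hE) transferConst_pos.le))

/-- **`∫∫ ‖D(Ψuᵢ)‖² ≤ 2 DB(M, E)`** for `i = 0, 2`. [folklore] -/
theorem integral_norm_fderiv_sq_le_dirichletBound (hs : ∀ x ∈ 𝒞½, ContDiffAt ℝ ∞ u x)
    (ha : ∀ θ : ℝ, ∀ x ∈ 𝒞½, u (rotZ θ x) = rotZ θ (u x))
    (hd : ∀ x ∈ 𝒞½, VectorCalculus.divergence u x = 0) {M E : ℝ≥0}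
    (hM : ∫⁻ x in 𝒞½, ‖angularVorticity u x‖ₑ ^ 2 ≤ M) (hE : ∫⁻ x in 𝒞½, ‖u x‖ₑ ^ 2 ≤ E)
    {i : Fin 3} (hi : i = 0 ∨ i = 2) :
    ∫ q : ℝ × ℝ, ‖fderiv ℝ (cutProfile u i) q‖ ^ 2 ≤ 2 * dirichletBound M E :=
  (integral_norm_fderiv_sq_le hs hi).trans
    (mul_le_mul_of_nonneg_left (integral_grad_sq_le_dirichletBound hs ha hd hM hE) (by norm_num))

/-- **The planar moments of the profiles**: for `m ≥ 1` and `i = 0, 2`,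
`∫∫ (Ψuᵢ)^{2m} ≤ K_m (C_T E) (2 DB(M, E))^{m-1}` (the two-dimensional Sobolev inequality,
accepted `exists_planar_even_moment_const`).
[cite: SereginZajaczkowski2007, proof of Lemma 4.2 ("and thus ∫∫|Ṽ|^q dϱdx₃ ≤ Φ₄(q,𝒜₂)")] -/
theorem integral_cutProfile_pow_le (hs : ∀ x ∈ 𝒞½, ContDiffAt ℝ ∞ u x)
    (ha : ∀ θ : ℝ, ∀ x ∈ 𝒞½, u (rotZ θ x) = rotZ θ (u x))
    (hd : ∀ x ∈ 𝒞½, VectorCalculus.divergence u x = 0) {M E : ℝ≥0}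
    (hM : ∫⁻ x in 𝒞½, ‖angularVorticity u x‖ₑ ^ 2 ≤ M) (hE : ∫⁻ x in 𝒞½, ‖u x‖ₑ ^ 2 ≤ E)
    {m : ℕ} (hm : 1 ≤ m) {i : Fin 3} (hi : i = 0 ∨ i = 2) :
    ∫ q : ℝ × ℝ, cutProfile u i q ^ (2 * m) ≤
      momentConst m * (transferConst * E) * (2 * dirichletBound M E) ^ (m - 1) := by
  have h1 : ContDiff ℝ 1 (cutProfile u i) :=
    (contDiff_cutProfile hs i).of_le (by exact_mod_cast (le_top : (1 : ℕ∞) ≤ ⊤))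
  have h := integral_pow_le_momentConst hm h1 (hasCompactSupport_cutProfile u i)
  have hA := integral_cutProfile_sq_le_energy hs ha hE i
  have hD := integral_norm_fderiv_sq_le_dirichletBound hs ha hd hM hE hi
  have hA0 : 0 ≤ ∫ q : ℝ × ℝ, cutProfile u i q ^ 2 := integral_nonneg fun q => sq_nonneg _
  have hD0 : 0 ≤ ∫ q : ℝ × ℝ, ‖fderiv ℝ (cutProfile u i) q‖ ^ 2 := integral_nonneg fun q => sq_nonneg _
  have hK := momentConst_nonneg m
  have hKE : 0 ≤ momentConst m * (transferConst * E) :=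
    mul_nonneg hK (mul_nonneg transferConst_pos.le (NNReal.coe_nonneg E))
  refine h.trans ?_
  gcongr

/-- The profiles vanish on the closed left half-plane `{ϱ ≤ 0}`. [folklore] -/
theorem cutProfile_eq_zero_of_nonpos {q : ℝ × ℝ} (hq : q.1 ≤ 0) (i : Fin 3) : cutProfile u i q = 0 := by
  refine cutProfile_eq_zero (fun h => ?_) i
  have := (tsupport_cutoffΨ_subset h).1.1
  linarith

end Moments

/-! ### Back to `ℝ³` on `𝒞̃₁` -/

/-- `𝒞̃₁ ⊆ 𝒞½`. [folklore] -/
theorem shell_one_subset_half : 𝒞₁ ⊆ 𝒞½ := by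
  intro x hx
  rw [mem_shell] at hx ⊢
  exact ⟨⟨by linarith [hx.1.1], by linarith [hx.1.2]⟩, by linarith [hx.2]⟩

/-- `Ψ = 1` on the meridian section of `𝒞̃₁`. [folklore] -/
theorem cutoffΨ_meridian_eq_one {x : ℝ³} (hx : x ∈ 𝒞₁) : cutoffΨ (meridian x) = 1 := by
  rw [mem_shell] at hx
  exact cutoffΨ_eq_one (q := meridian x) ⟨hx.1.1.le, hx.1.2.le⟩ hx.2.le

/-- **The constant `B_m(M, E)`** bounding `∫_{𝒞̃₁} |u^a|^{2m} dx`: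
`B_m = (23/8) c₂ 2^{m+1} · K_m (C_T E) (2 DB(M,E))^{m-1}`. [folklore] -/
def momentBound (m : ℕ) (M E : ℝ) : ℝ :=
  23 / 8 * radialConst₂ * 2 ^ (m + 1) * (momentConst m * (transferConst * E) * (2 * dirichletBound M E) ^ (m - 1))

/-- `B_m` is non-negative on non-negative arguments. [folklore] -/
theorem momentBound_nonneg (m : ℕ) {M E : ℝ} (hM : 0 ≤ M) (hE : 0 ≤ E) : 0 ≤ momentBound m M E := by
  unfold momentBound
  have := radialConst₂_pos.le; have := momentConst_nonneg m; have := transferConst_pos.le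
  have := dirichletBound_nonneg hM hE
  positivity

/-- `B_m` is non-decreasing in each variable (on non-negative arguments). [folklore] -/
theorem momentBound_mono (m : ℕ) {M M' E E' : ℝ} (hM0 : 0 ≤ M) (hE0 : 0 ≤ E) (hM : M ≤ M')
    (hE : E ≤ E') : momentBound m M E ≤ momentBound m M' E' := by
  unfold momentBound
  have := radialConst₂_pos.le; have := momentConst_nonneg m; have := transferConst_pos.le
  have h0 := dirichletBound_nonneg hM0 hE0
  have h1 := dirichletBound_mono hM hE
  have h2 : 0 ≤ momentConst m * (transferConst * E') :=
    mul_nonneg (momentConst_nonneg m) (mul_nonneg transferConst_pos.le (hE0.trans hE))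
  gcongr

section Back

variable {u : ℝ³ → ℝ³}

/-- **The even moments of the poloidal speed on `𝒞̃₁`**: for `m ≥ 1`,
`∫_{𝒞̃₁} |u^a|^{2m} dx ≤ B_m(M, E)`. On `𝒞̃₁`, `Ψ = 1` and `|u^a|² = (a² + b²) ∘ meridian`, so
`|u^a|^{2m} ≤ 2^m (a^{2m} + b^{2m}) ∘ meridian =: Y ∘ meridian`; `∫ Y ∘ meridian dx ≤ (23/8)(c₂/2)
∫∫ Y(|ϱ|, z) = (23/8) c₂ ∫∫ Y` (`dx = ϱ dϱ dφ dz`, `ϱ ≤ 23/8`), and the planar moments are bounded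
by `integral_cutProfile_pow_le`.
[cite: SereginZajaczkowski2007, proof of Lemma 4.2 ("Now, (4.2) immediately follows")] -/
theorem setLIntegral_poloidalSpeed_pow_le (hs : ∀ x ∈ 𝒞½, ContDiffAt ℝ ∞ u x)
    (ha : ∀ θ : ℝ, ∀ x ∈ 𝒞½, u (rotZ θ x) = rotZ θ (u x))
    (hd : ∀ x ∈ 𝒞½, VectorCalculus.divergence u x = 0) {M E : ℝ≥0}
    (hM : ∫⁻ x in 𝒞½, ‖angularVorticity u x‖ₑ ^ 2 ≤ M) (hE : ∫⁻ x in 𝒞½, ‖u x‖ₑ ^ 2 ≤ E)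
    {m : ℕ} (hm : 1 ≤ m) :
    ∫⁻ x in 𝒞₁, ENNReal.ofReal (poloidalSpeed u x ^ (2 * m)) ≤ ENNReal.ofReal (momentBound m M E) := by
  set a := cutProfile u 0 with ha'
  set b := cutProfile u 2 with hb'
  set Y : ℝ × ℝ → ℝ := fun q => 2 ^ m * (a q ^ (2 * m) + b q ^ (2 * m)) with hY
  have hY0 : ∀ q, 0 ≤ Y q := fun q => by
    have h1 : 0 ≤ a q ^ (2 * m) := by rw [pow_mul]; positivity
    have h2 : 0 ≤ b q ^ (2 * m) := by rw [pow_mul]; positivity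
    positivity
  -- (ii) pointwise on `𝒞̃₁`
  have ha1 : ∀ θ : ℝ, ∀ x ∈ 𝒞₁, u (rotZ θ x) = rotZ θ (u x) := fun θ x hx =>
    ha θ x (shell_one_subset_half hx)
  have hpt : ∀ x ∈ 𝒞₁, poloidalSpeed u x ^ (2 * m) ≤ Y (meridian x) := by
    intro x hx
    have hsq := poloidalSpeed_sq_eq_meridianPoint (by norm_num : (0 : ℝ) ≤ 5 / 16) ha1 hx
    have hΨ := cutoffΨ_meridian_eq_one hx
    have haq : a (meridian x) = u (meridianPoint (meridian x)) 0 := by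
      rw [ha', cutProfile_apply, hΨ, one_mul]
    have hbq : b (meridian x) = u (meridianPoint (meridian x)) 2 := by
      rw [hb', cutProfile_apply, hΨ, one_mul]
    rw [pow_mul, hsq, ← haq, ← hbq, hY]
    dsimp only
    rw [pow_mul, pow_mul]
    -- `(s + t)^m ≤ 2^m (s^m + t^m)` for `s, t ≥ 0` (the tree's `add_pow_le_two_pow` of
    -- `NumberTheory/LFunctions/XiMomentConcentration`, inlined to keep the imports topical)
    set s := a (meridian x) ^ 2 with hs'
    set t := b (meridian x) ^ 2 with ht'
    have hs0 : 0 ≤ s := sq_nonneg _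
    have ht0 : 0 ≤ t := sq_nonneg _
    have h1 : s + t ≤ 2 * max s t := by
      rcases le_total s t with h | h
      · rw [max_eq_right h]; linarith
      · rw [max_eq_left h]; linarith
    have h2 : (max s t) ^ m ≤ s ^ m + t ^ m := by
      rcases le_total s t with h | h
      · rw [max_eq_right h]; linarith [pow_nonneg hs0 m]
      · rw [max_eq_left h]; linarith [pow_nonneg ht0 m]
    calc (s + t) ^ m ≤ (2 * max s t) ^ m := pow_le_pow_left₀ (add_nonneg hs0 ht0) h1 m
      _ = 2 ^ m * (max s t) ^ m := mul_pow _ _ _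
      _ ≤ 2 ^ m * (s ^ m + t ^ m) := mul_le_mul_of_nonneg_left h2 (by positivity)
  -- (iv) the lift of `Y`
  have hYsupp : tsupport Y ⊆ tsupport cutoffΘ := by
    refine (closure_minimal (fun q hq => ?_) (isClosed_tsupport _)).trans
      tsupport_cutoffΨ_subset_tsupport_cutoffΘ
    by_contra hq'
    apply hq
    show Y q = 0
    rw [hY]
    dsimp only
    rw [ha', hb', cutProfile_eq_zero hq', cutProfile_eq_zero hq', zero_pow (by omega), add_zero, mul_zero]
  have hYc : Continuous Y := by
    rw [hY]
    exact continuous_const.mul (((contDiff_cutProfile hs 0).continuous.pow _).add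
      ((contDiff_cutProfile hs 2).continuous.pow _))
  have hXa : IsAxisymmetricScalar fun x => Y (meridian x) * (1 : ℝ) :=
    isAxisymmetricScalar_lift hYsupp fun _ _ _ => rfl
  have hXc : Continuous fun x => Y (meridian x) * (1 : ℝ) := continuous_lift hYc hYsupp continuousOn_const
  have hXs : HasCompactSupport fun x => Y (meridian x) * (1 : ℝ) := hasCompactSupport_lift hYsupp
  have hX0 : ∀ x, 0 ≤ Y (meridian x) * (1 : ℝ) := fun x => by rw [mul_one]; exact hY0 _
  have hXsupp : ∀ x, Y (meridian x) * (1 : ℝ) ≠ 0 → (9 / 32 : ℝ) ≤ cylRadius x ∧ cylRadius x ≤ 23 / 8 :=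
    fun x hx => cylRadius_mem_of_lift_ne_zero (F := fun _ => (1 : ℝ)) hYsupp hx
  have hXi : Integrable fun x => Y (meridian x) * (1 : ℝ) := hXc.integrable_of_hasCompactSupport hXs
  -- (v) the upper comparison
  have key := integral_le_mul_integral_profile (by norm_num : (0 : ℝ) < 9 / 32) hXa hXc hXs hX0 hXsupp
  -- (vi) evenness
  have hYi : Integrable Y := hYc.integrable_of_hasCompactSupport
    (HasCompactSupport.of_support_subset_isCompact hasCompactSupport_cutoffΘ
      ((subset_tsupport _).trans hYsupp))
  have hYz : ∀ q : ℝ × ℝ, q.1 ≤ 0 → Y q = 0 := fun q hq => by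
    rw [hY]; dsimp only
    rw [ha', hb', cutProfile_eq_zero_of_nonpos hq, cutProfile_eq_zero_of_nonpos hq, zero_pow (by omega),
      add_zero, mul_zero]
  have heven : ∫ q : ℝ × ℝ, Y (meridian (meridianPoint q)) * (1 : ℝ) = 2 * ∫ q, Y q := by
    have : ∀ q : ℝ × ℝ, Y (meridian (meridianPoint q)) * (1 : ℝ) = Y (|q.1|, q.2) := fun q => by
      rw [mul_one, meridian_apply, cylRadius_meridianPoint_eq_abs, meridianPoint_apply_two]
    simp_rw [this]
    exact integral_comp_abs_fst hYi hYz
  -- (vii) the planar moments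
  have hmom : ∫ q, Y q ≤ 2 ^ m * (2 * (momentConst m * (transferConst * E) * (2 * dirichletBound M E) ^ (m - 1))) := by
    have iA : Integrable fun q => a q ^ (2 * m) :=
      ((contDiff_cutProfile hs 0).continuous.pow _).integrable_of_hasCompactSupport
        ((hasCompactSupport_cutProfile u 0).comp_left (g := fun v : ℝ => v ^ (2 * m)) (by simp; omega))
    have iB : Integrable fun q => b q ^ (2 * m) :=
      ((contDiff_cutProfile hs 2).continuous.pow _).integrable_of_hasCompactSupport
        ((hasCompactSupport_cutProfile u 2).comp_left (g := fun v : ℝ => v ^ (2 * m)) (by simp; omega))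
    rw [hY, integral_const_mul, integral_add iA iB]
    have h0 := integral_cutProfile_pow_le hs ha hd hM hE hm (i := 0) (Or.inl rfl)
    have h2 := integral_cutProfile_pow_le hs ha hd hM hE hm (i := 2) (Or.inr rfl)
    gcongr
    linarith
  -- assembling
  have hc2 := radialConst₂_pos
  calc ∫⁻ x in 𝒞₁, ENNReal.ofReal (poloidalSpeed u x ^ (2 * m))
      ≤ ∫⁻ x in 𝒞₁, ENNReal.ofReal (Y (meridian x) * (1 : ℝ)) :=
        setLIntegral_mono' (isOpen_shell _ _ _).measurableSet fun x hx => by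
          rw [mul_one]; exact ENNReal.ofReal_le_ofReal (hpt x hx)
    _ ≤ ∫⁻ x, ENNReal.ofReal (Y (meridian x) * (1 : ℝ)) := setLIntegral_le_lintegral _ _
    _ = ENNReal.ofReal (∫ x, Y (meridian x) * (1 : ℝ)) := lintegral_ofReal_eq_ofReal_integral hXi hX0
    _ ≤ ENNReal.ofReal (23 / 8 * (radialConst₂ / 2) * ∫ q : ℝ × ℝ, Y (meridian (meridianPoint q)) * (1 : ℝ)) :=
        ENNReal.ofReal_le_ofReal key
    _ ≤ ENNReal.ofReal (momentBound m M E) := by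
        refine ENNReal.ofReal_le_ofReal ?_
        rw [heven, momentBound]
        have : (23 / 8 : ℝ) * (radialConst₂ / 2) * (2 * ∫ q, Y q) = 23 / 8 * radialConst₂ * ∫ q, Y q := by ring
        rw [this]
        calc 23 / 8 * radialConst₂ * ∫ q, Y q
            ≤ 23 / 8 * radialConst₂ * (2 ^ m * (2 * (momentConst m * (transferConst * E) *
                (2 * dirichletBound M E) ^ (m - 1)))) := by gcongr
          _ = 23 / 8 * radialConst₂ * 2 ^ (m + 1) *
                (momentConst m * (transferConst * E) * (2 * dirichletBound M E) ^ (m - 1)) := by ring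

end Back

/-! ### The function `Φ₄` and the discharge -/

/-- `𝒞̃₁` has finite volume (it lies in the ball of radius `4`). [folklore] -/
theorem volume_shell_one_lt_top : volume 𝒞₁ < ⊤ := by
  refine lt_of_le_of_lt (measure_mono fun x hx => ?_) (measure_closedBall_lt_top (x := (0 : ℝ³)) (r := 4))
  rw [mem_shell] at hx
  rw [mem_closedBall, dist_zero_right]
  have hsq : ‖x‖ ^ 2 ≤ 4 ^ 2 := by
    rw [norm_sq_eq_cylRadius_sq_add]
    nlinarith [cylRadius_nonneg x, hx.1.2, abs_lt.1 hx.2, sq_abs (x 2)]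
  exact (pow_le_pow_iff_left₀ (norm_nonneg x) (by norm_num) two_ne_zero).1 hsq

/-- The volume of `𝒞̃₁`, as a real number. [folklore] -/
def volTarget : ℝ := (volume 𝒞₁).toReal

/-- `0 ≤ |𝒞̃₁|`. [folklore] -/
theorem volTarget_nonneg : 0 ≤ volTarget := ENNReal.toReal_nonneg

/-- **The function `Φ₄(q, M, E) = |𝒞̃₁| + Σ_{m ≤ ⌈q⌉} B_m(M, E)`** of the kinematic half of
Lemma 4.2 (the printed "`Φ₄(q, 𝒜₂)`", with the vorticity and energy inputs kept separate).
[cite: SereginZajaczkowski2007, proof of Lemma 4.2 (the function Φ₄)] -/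
def Phi4 (q M E : ℝ≥0) : ℝ≥0 :=
  (volTarget + ∑ m ∈ Finset.range (⌈(q : ℝ)⌉₊ + 1), momentBound m M E).toNNReal

/-- `Φ₄` is non-decreasing in `E`. [folklore] -/
theorem Phi4_mono_E (q M : ℝ≥0) : Monotone (Phi4 q M) := by
  intro E E' h
  unfold Phi4
  refine Real.toNNReal_le_toNNReal (add_le_add le_rfl (Finset.sum_le_sum fun m _ => ?_))
  exact momentBound_mono m M.coe_nonneg E.coe_nonneg le_rfl (NNReal.coe_le_coe.2 h)

/-- `Φ₄` is non-decreasing in `M`. [folklore] -/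
theorem Phi4_mono_M (q E : ℝ≥0) : Monotone fun M => Phi4 q M E := by
  intro M M' h
  unfold Phi4
  refine Real.toNNReal_le_toNNReal (add_le_add le_rfl (Finset.sum_le_sum fun m _ => ?_))
  exact momentBound_mono m M.coe_nonneg E.coe_nonneg (NNReal.coe_le_coe.2 h) le_rfl

/-- `Φ₄` is non-decreasing in `q` (more non-negative terms). [folklore] -/
theorem Phi4_mono_q (M E : ℝ≥0) : Monotone fun q => Phi4 q M E := by
  intro q q' h
  unfold Phi4
  refine Real.toNNReal_le_toNNReal (add_le_add le_rfl ?_)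
  refine Finset.sum_le_sum_of_subset_of_nonneg (Finset.range_mono ?_) fun m _ _ =>
    momentBound_nonneg m M.coe_nonneg E.coe_nonneg
  exact Nat.succ_le_succ (Nat.ceil_mono (NNReal.coe_le_coe.2 h))

/-- **The envelope of a real power by even powers**: for `t ≥ 0`, `1 ≤ q ≤ 2m`,
`t^q ≤ 1 + t^{2m}`. [folklore] -/
theorem rpow_le_one_add_pow {t q : ℝ} (ht : 0 ≤ t) (hq : 0 ≤ q) {n : ℕ} (hqn : q ≤ n) :
    t ^ q ≤ 1 + t ^ n := by
  rcases le_or_gt t 1 with h | h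
  · have h1 : t ^ q ≤ 1 := Real.rpow_le_one ht h hq
    have h2 : 0 ≤ t ^ n := pow_nonneg ht n
    linarith
  · have h1 : t ^ q ≤ t ^ (n : ℝ) := Real.rpow_le_rpow_of_exponent_le h.le hqn
    rw [Real.rpow_natCast] at h1
    linarith

/-- **Seregin–Zajaczkowski 2007, Lemma 4.2, second half of the proof — PROVED.** The named fact
`PoloidalLqOfVorticityL2` holds, with `Φ₄ = Phi4`: given `u` smooth, axially symmetric and
divergence free on `𝒞½` with `∫_{𝒞½} ω_φ² ≤ M`, `∫_{𝒞½} |u|² ≤ E`, and `q ≥ 1`, put `m = ⌈q⌉`;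
then `|u^a|^q ≤ 1 + |u^a|^{2m}` pointwise, so
`∫_{𝒞̃₁} |u^a|^q ≤ |𝒞̃₁| + ∫_{𝒞̃₁} |u^a|^{2m} ≤ |𝒞̃₁| + B_m(M, E) ≤ Φ₄(q, M, E)`
(`setLIntegral_poloidalSpeed_pow_le`). [cite: SereginZajaczkowski2007, proof of Lemma 4.2 ((4.3), (4.4), (4.6), (4.7) and the last two displays)] -/
theorem PoloidalLqOfVorticityL2_holds : PoloidalLqOfVorticityL2 := by
  refine ⟨Phi4, Phi4_mono_E, Phi4_mono_M, Phi4_mono_q, ?_⟩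
  intro u hs ha hd M E hM hE q hq
  -- the even exponent `2m ≥ q`
  set m : ℕ := ⌈(q : ℝ)⌉₊ with hm
  have hq1 : (1 : ℝ) ≤ q := by exact_mod_cast hq
  have hm1 : 1 ≤ m := Nat.one_le_iff_ne_zero.2 (Nat.pos_iff_ne_zero.1 (Nat.ceil_pos.2 (by linarith)))
  have hqm : (q : ℝ) ≤ ((2 * m : ℕ) : ℝ) := by
    have h1 : (q : ℝ) ≤ m := Nat.le_ceil _
    have h2 : (m : ℝ) ≤ ((2 * m : ℕ) : ℝ) := by exact_mod_cast (by omega : m ≤ 2 * m)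
    exact h1.trans h2
  -- pointwise envelope in `ℝ≥0∞`
  have hpt : ∀ x, ‖poloidalSpeed u x‖ₑ ^ (q : ℝ) ≤ 1 + ENNReal.ofReal (poloidalSpeed u x ^ (2 * m)) := by
    intro x
    have h0 := poloidalSpeed_nonneg u x
    rw [Real.enorm_eq_ofReal h0, ENNReal.ofReal_rpow_of_nonneg h0 (by positivity), ← ENNReal.ofReal_one,
      ← ENNReal.ofReal_add zero_le_one (pow_nonneg h0 _)]
    exact ENNReal.ofReal_le_ofReal (rpow_le_one_add_pow h0 (by positivity) hqm)
  -- the main estimate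
  have hmain := setLIntegral_poloidalSpeed_pow_le hs ha hd hM hE hm1
  have hvol : volume 𝒞₁ = ENNReal.ofReal volTarget := by
    rw [volTarget, ENNReal.ofReal_toReal volume_shell_one_lt_top.ne]
  have hB0 : ∀ m', 0 ≤ momentBound m' M E := fun m' => momentBound_nonneg m' M.coe_nonneg E.coe_nonneg
  calc ∫⁻ x in 𝒞₁, ‖poloidalSpeed u x‖ₑ ^ (q : ℝ)
      ≤ ∫⁻ x in 𝒞₁, (1 + ENNReal.ofReal (poloidalSpeed u x ^ (2 * m))) :=
        setLIntegral_mono' (isOpen_shell _ _ _).measurableSet fun x _ => hpt x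
    _ = volume 𝒞₁ + ∫⁻ x in 𝒞₁, ENNReal.ofReal (poloidalSpeed u x ^ (2 * m)) := by
        rw [lintegral_add_left measurable_const, setLIntegral_const, one_mul]
    _ ≤ ENNReal.ofReal volTarget + ENNReal.ofReal (momentBound m M E) := by
        rw [hvol]
        exact add_le_add le_rfl hmain
    _ = ENNReal.ofReal (volTarget + momentBound m M E) :=
        (ENNReal.ofReal_add volTarget_nonneg (hB0 m)).symm
    _ ≤ ENNReal.ofReal (volTarget + ∑ m' ∈ Finset.range (⌈(q : ℝ)⌉₊ + 1), momentBound m' M E) := by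
        refine ENNReal.ofReal_le_ofReal (add_le_add le_rfl ?_)
        rw [← hm]
        exact Finset.single_le_sum (f := fun m' => momentBound m' M E) (fun m' _ => hB0 m')
          (Finset.mem_range.2 (Nat.lt_succ_self m))
    _ = (Phi4 q M E : ℝ≥0∞) := rfl

end SereginZajaczkowski2007

end Literature.Analysis.FluidPDE
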